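import Literature.Analysis.PDE.QuasilinearFlatEstimate
import HarnessLib

/-!
# The flat energy estimate with a level-independent top constant (topic `Analysis/PDE`)

Layer (III), step 5b (sharp form), of the programme to prove short-time existence for
quasilinear strictly parabolic systems on a closed manifold (hypothesis `hQL` of
`Literature.Geometry.Riemannian.ricciFlow_shortTime_existence_of_quasilinear`). The boundedness of
the frozen Picard scheme at *all* orders on one time interval requires that, at every order `K`,
the small factor `δ²` of the top-order term of the source estimate be multiplied by a constant
independent of `K`. This file proves the flat estimates of `QuasilinearFlatEstimate.lean` in this
form: with `ŵ = cut • z`,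

  `E_K(Θ♭(z)) ≤ 16 |ι|⁴ A⁴ δ² Σ_{ab} E_K(∂_a ∂_b ŵ) + B_K(R) (1 + E_{K+1}(z))`,

and the analogous difference estimate. The top-order comparison is made in the same chart
(`cut • D²z = D²ŵ - [D², cut] z`), through the frame expansion of the Hessian and the
Cauchy–Schwarz inequality for the quadratic forms `E_K`.

* `sobolevEnergy_sum_smul_le` — `E_K(Σⱼ cⱼ fⱼ) ≤ (Σⱼ cⱼ²) Σⱼ E_K(fⱼ)`;
* `sobolevEnergy_hess_apply_le` — `E_K(y ↦ D²ŵ(y) v w) ≤ ‖v‖² ‖w‖² Σ_{ab} E_K(∂_a ∂_b ŵ)`;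
* `energy_thetaFlat_le_sharp`, `energy_thetaFlat_sub_le_sharp`.

Everything is proved; no named fact and no `sorry` is introduced.

## References

* M. E. Taylor, *Partial Differential Equations III*, 2nd ed., Springer 2011, Ch. 15, §7.
  [TaylorPDEIII2011]
-/

noncomputable section

open MeasureTheory Set Function Filter InnerProductSpace
open scoped ENNReal ContDiff RealInnerProductSpace

namespace Literature.Analysis.PDE

open Literature.Analysis.FunctionSpaces

variable {E' : Type*} [NormedAddCommGroup E'] [InnerProductSpace ℝ E'] [FiniteDimensional ℝ E']
  [MeasurableSpace E'] [BorelSpace E']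
variable {W : Type*} [NormedAddCommGroup W] [InnerProductSpace ℝ W]

/-! ### Cauchy–Schwarz for the energies of linear combinations -/

omit [MeasurableSpace E'] [BorelSpace E'] [FiniteDimensional ℝ E'] in
/-- Pointwise Cauchy–Schwarz: `‖Σⱼ cⱼ xⱼ‖² ≤ (Σⱼ cⱼ²) Σⱼ ‖xⱼ‖²`. [folklore] -/
theorem norm_sum_smul_sq_le {J : Type*} (s : Finset J) (c : J → ℝ) (x : J → W) :
    ‖∑ j ∈ s, c j • x j‖ ^ 2 ≤ (∑ j ∈ s, c j ^ 2) * ∑ j ∈ s, ‖x j‖ ^ 2 := by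
  have h1 : ‖∑ j ∈ s, c j • x j‖ ≤ ∑ j ∈ s, |c j| * ‖x j‖ :=
    (norm_sum_le _ _).trans (Finset.sum_le_sum fun j _ ↦ by rw [norm_smul, Real.norm_eq_abs])
  have h2 := Finset.sum_mul_sq_le_sq_mul_sq s (fun j ↦ |c j|) (fun j ↦ ‖x j‖)
  simp only [sq_abs] at h2
  calc ‖∑ j ∈ s, c j • x j‖ ^ 2 ≤ (∑ j ∈ s, |c j| * ‖x j‖) ^ 2 := pow_le_pow_left₀ (norm_nonneg _) h1 2
    _ ≤ _ := h2

/-- The `L²` form of Cauchy–Schwarz for linear combinations: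
`∫ ‖Σⱼ cⱼ fⱼ‖² ≤ (Σⱼ cⱼ²) Σⱼ ∫ ‖fⱼ‖²` for continuous `fⱼ`. [folklore] -/
theorem lintegral_sum_smul_sq_le {J : Type*} (s : Finset J) (c : J → ℝ) {f : J → E' → W} (hf : ∀ j, Continuous (f j)) :
    (∫⁻ y, ‖∑ j ∈ s, c j • f j y‖ₑ ^ 2) ≤ ENNReal.ofReal (∑ j ∈ s, c j ^ 2) * ∑ j ∈ s, ∫⁻ y, ‖f j y‖ₑ ^ 2 := by
  classical
  have hm : ∀ j, AEMeasurable (fun y ↦ ‖f j y‖ₑ ^ 2) volume := fun j ↦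
    ((continuous_enorm.comp (hf j)).measurable.pow_const 2).aemeasurable
  rw [← lintegral_finsetSum' _ fun j _ ↦ hm j, ← lintegral_const_mul' _ _ ENNReal.ofReal_ne_top]
  refine lintegral_mono fun y ↦ ?_
  have h := norm_sum_smul_sq_le s c (fun j ↦ f j y)
  rw [← ofReal_norm, ← ENNReal.ofReal_pow (norm_nonneg _)]
  have hr : ENNReal.ofReal (∑ j ∈ s, c j ^ 2) * ∑ j ∈ s, ‖f j y‖ₑ ^ 2 = ENNReal.ofReal ((∑ j ∈ s, c j ^ 2) * ∑ j ∈ s, ‖f j y‖ ^ 2) := by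
    rw [ENNReal.ofReal_mul (Finset.sum_nonneg fun j _ ↦ sq_nonneg _)]
    congr 1
    rw [ENNReal.ofReal_sum_of_nonneg fun j _ ↦ sq_nonneg _]
    exact Finset.sum_congr rfl fun j _ ↦ by rw [← ofReal_norm, ENNReal.ofReal_pow (norm_nonneg _)]
  rw [hr]
  exact ENNReal.ofReal_le_ofReal h

/-- **Cauchy–Schwarz for energies of linear combinations**:
`E_k(Σⱼ cⱼ fⱼ) ≤ (Σⱼ cⱼ²) Σⱼ E_k(fⱼ)` for smooth `fⱼ`. [folklore] -/
theorem sobolevEnergy_sum_smul_le {J : Type*} (s : Finset J) (c : J → ℝ) (k : ℕ) :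
    ∀ {f : J → E' → W}, (∀ j, ContDiff ℝ ∞ (f j)) →
      sobolevEnergy k (fun y ↦ ∑ j ∈ s, c j • f j y) ≤ ENNReal.ofReal (∑ j ∈ s, c j ^ 2) * ∑ j ∈ s, sobolevEnergy k (f j) := by
  classical
  induction k with
  | zero =>
    intro f hf
    simp only [sobolevEnergy_zero_left]
    exact lintegral_sum_smul_sq_le s c fun j ↦ (hf j).continuous
  | succ k ih =>
    intro f hf
    set e := stdOrthonormalBasis ℝ E' with he
    rw [sobolevEnergy_succ]
    have hderiv : ∀ i, (fun y ↦ fderiv ℝ (fun y ↦ ∑ j ∈ s, c j • f j y) y (e i)) = fun y ↦ ∑ j ∈ s, c j • fderiv ℝ (f j) y (e i) := by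
      intro i; funext y
      have hd : ∀ j ∈ s, DifferentiableAt ℝ (fun y ↦ c j • f j y) y := fun j _ ↦ (((hf j).differentiable (by simp)) y).const_smul _
      rw [fderiv_fun_sum hd, FunLike.coe_sum, Finset.sum_apply]
      refine Finset.sum_congr rfl fun j _ ↦ ?_
      rw [fderiv_fun_const_smul (((hf j).differentiable (by simp)) y), FunLike.coe_smul, Pi.smul_apply]
    have hfi : ∀ i j, ContDiff ℝ ∞ fun y ↦ fderiv ℝ (f j) y (e i) := fun i j ↦ ((hf j).fderiv_right (m := ∞) (by norm_cast)).clm_apply contDiff_const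
    have hsum : ∀ j, sobolevEnergy (k + 1) (f j) = (∫⁻ y, ‖f j y‖ₑ ^ 2) + ∑ i, sobolevEnergy k (fun y ↦ fderiv ℝ (f j) y (e i)) := fun j ↦ sobolevEnergy_succ k (f j)
    calc (∫⁻ y, ‖∑ j ∈ s, c j • f j y‖ₑ ^ 2) + ∑ i, sobolevEnergy k (fun y ↦ fderiv ℝ (fun y ↦ ∑ j ∈ s, c j • f j y) y (e i))
        ≤ ENNReal.ofReal (∑ j ∈ s, c j ^ 2) * ∑ j ∈ s, (∫⁻ y, ‖f j y‖ₑ ^ 2) +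
            ∑ i, ENNReal.ofReal (∑ j ∈ s, c j ^ 2) * ∑ j ∈ s, sobolevEnergy k (fun y ↦ fderiv ℝ (f j) y (e i)) := by
          refine add_le_add (lintegral_sum_smul_sq_le s c fun j ↦ (hf j).continuous) (Finset.sum_le_sum fun i _ ↦ ?_)
          rw [hderiv i]
          exact ih (hfi i)
      _ = ENNReal.ofReal (∑ j ∈ s, c j ^ 2) * ∑ j ∈ s, sobolevEnergy (k + 1) (f j) := by
          simp only [hsum]
          rw [Finset.sum_add_distrib, Finset.sum_comm, ← Finset.mul_sum, mul_add]

/-! ### The Hessian through frame second derivatives -/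

omit [MeasurableSpace E'] [BorelSpace E'] in
/-- **Frame expansion of the Hessian**: `D²ŵ(y) v w = Σ_{ab} ⟪e_a, v⟫ ⟪e_b, w⟫ ∂_a ∂_b ŵ(y)` with
`∂_a ∂_b ŵ(y) = fderiv (z ↦ fderiv ŵ z e_b) y e_a`, for `ŵ` twice differentiable at `y`. [folklore] -/
theorem hess_apply_eq_sum {ŵ : E' → W} {y : E'} (h : DifferentiableAt ℝ (fderiv ℝ ŵ) y) (v w : E') :
    fderiv ℝ (fderiv ℝ ŵ) y v w = ∑ a, ∑ b, (⟪stdOrthonormalBasis ℝ E' a, v⟫ * ⟪stdOrthonormalBasis ℝ E' b, w⟫) •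
      fderiv ℝ (fun z ↦ fderiv ℝ ŵ z (stdOrthonormalBasis ℝ E' b)) y (stdOrthonormalBasis ℝ E' a) := by
  set e := stdOrthonormalBasis ℝ E' with he
  have hv : v = ∑ a, ⟪e a, v⟫ • e a := (e.sum_repr' v).symm
  have hw : w = ∑ b, ⟪e b, w⟫ • e b := (e.sum_repr' w).symm
  have hab : ∀ a b, fderiv ℝ (fderiv ℝ ŵ) y (e a) (e b) = fderiv ℝ (fun z ↦ fderiv ℝ ŵ z (e b)) y (e a) := by
    intro a b
    rw [fderiv_clm_apply h (differentiableAt_const _)]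
    simp
  calc fderiv ℝ (fderiv ℝ ŵ) y v w = fderiv ℝ (fderiv ℝ ŵ) y (∑ a, ⟪e a, v⟫ • e a) w := by rw [← hv]
    _ = ∑ a, ⟪e a, v⟫ • fderiv ℝ (fderiv ℝ ŵ) y (e a) w := by
        rw [map_sum, FunLike.coe_sum, Finset.sum_apply]
        exact Finset.sum_congr rfl fun a _ ↦ by rw [map_smul, FunLike.coe_smul, Pi.smul_apply]
    _ = ∑ a, ⟪e a, v⟫ • ∑ b, ⟪e b, w⟫ • fderiv ℝ (fderiv ℝ ŵ) y (e a) (e b) := by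
        refine Finset.sum_congr rfl fun a _ ↦ ?_
        congr 1
        conv_lhs => rw [hw]
        rw [map_sum]
        exact Finset.sum_congr rfl fun b _ ↦ by rw [map_smul]
    _ = _ := by
        refine Finset.sum_congr rfl fun a _ ↦ ?_
        rw [Finset.smul_sum]
        refine Finset.sum_congr rfl fun b _ ↦ ?_
        rw [smul_smul, hab]

/-- **Energies of Hessian components through frame second derivatives**:
`E_k(y ↦ D²ŵ(y) v w) ≤ ‖v‖² ‖w‖² Σ_{ab} E_k(∂_a ∂_b ŵ)` for smooth `ŵ`. [folklore] -/
theorem sobolevEnergy_hess_apply_le (k : ℕ) {ŵ : E' → W} (hŵ : ContDiff ℝ ∞ ŵ) (v w : E') :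
    sobolevEnergy k (fun y ↦ fderiv ℝ (fderiv ℝ ŵ) y v w) ≤ ENNReal.ofReal ((‖v‖ * ‖w‖) ^ 2) *
      ∑ a, ∑ b, sobolevEnergy k (fun y ↦ fderiv ℝ (fun z ↦ fderiv ℝ ŵ z (stdOrthonormalBasis ℝ E' b)) y (stdOrthonormalBasis ℝ E' a)) := by
  classical
  set e := stdOrthonormalBasis ℝ E' with he
  have hD : ContDiff ℝ ∞ (fderiv ℝ ŵ) := hŵ.fderiv_right (m := ∞) (by norm_cast)
  have heq : (fun y ↦ fderiv ℝ (fderiv ℝ ŵ) y v w) = fun y ↦ ∑ q ∈ (Finset.univ : Finset (Fin (Module.finrank ℝ E') × Fin (Module.finrank ℝ E'))),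
      (⟪e q.1, v⟫ * ⟪e q.2, w⟫) • fderiv ℝ (fun z ↦ fderiv ℝ ŵ z (e q.2)) y (e q.1) := by
    funext y
    rw [hess_apply_eq_sum ((hD.differentiable (by simp)) y), ← Finset.univ_product_univ, Finset.sum_product]
  rw [heq]
  have hf : ∀ q : Fin (Module.finrank ℝ E') × Fin (Module.finrank ℝ E'), ContDiff ℝ ∞ fun y ↦ fderiv ℝ (fun z ↦ fderiv ℝ ŵ z (e q.2)) y (e q.1) :=
    fun q ↦ ((hD.clm_apply contDiff_const).fderiv_right (m := ∞) (by norm_cast)).clm_apply contDiff_const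
  refine (sobolevEnergy_sum_smul_le _ _ k hf).trans ?_
  have hc : ∑ q ∈ (Finset.univ : Finset (Fin (Module.finrank ℝ E') × Fin (Module.finrank ℝ E'))), (⟪e q.1, v⟫ * ⟪e q.2, w⟫) ^ 2 = (‖v‖ * ‖w‖) ^ 2 := by
    rw [← Finset.univ_product_univ, Finset.sum_product]
    have h1 : ∑ a, ⟪e a, v⟫ ^ 2 = ‖v‖ ^ 2 := by simpa [real_inner_comm] using e.sum_sq_inner_left v
    have h2 : ∑ b, ⟪e b, w⟫ ^ 2 = ‖w‖ ^ 2 := by simpa [real_inner_comm] using e.sum_sq_inner_left w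
    calc ∑ a, ∑ b, (⟪e a, v⟫ * ⟪e b, w⟫) ^ 2 = ∑ a, ⟪e a, v⟫ ^ 2 * ∑ b, ⟪e b, w⟫ ^ 2 := by
          refine Finset.sum_congr rfl fun a _ ↦ ?_; rw [Finset.mul_sum]; exact Finset.sum_congr rfl fun b _ ↦ by ring
      _ = (‖v‖ * ‖w‖) ^ 2 := by rw [← Finset.sum_mul, h1, h2]; ring
  rw [hc, ← Finset.univ_product_univ, Finset.sum_product]

/-! ### The commutator of the Hessian with a cut-off -/

omit [MeasurableSpace E'] [BorelSpace E'] [FiniteDimensional ℝ E'] in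
/-- **Leibniz for second derivatives of a cut-off product**: with `ŵ = cut • z`,
`∂_v (y ↦ Dŵ(y) w) = cut ∂_v (y ↦ Dz(y) w) + (∂_v cut) Dz w + (∂_v ∂_w cut) z + (∂_w cut) ∂_v z`.
[folklore] -/
theorem fderiv_fderiv_smul_apply {cut : E' → ℝ} {z : E' → W} (hcut : ContDiff ℝ ∞ cut) (hz : ContDiff ℝ ∞ z) (y v w : E') :
    fderiv ℝ (fun y ↦ fderiv ℝ (fun y ↦ cut y • z y) y w) y v =
      cut y • fderiv ℝ (fun y ↦ fderiv ℝ z y w) y v + fderiv ℝ cut y v • fderiv ℝ z y w +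
        fderiv ℝ (fun y ↦ fderiv ℝ cut y w) y v • z y + fderiv ℝ cut y w • fderiv ℝ z y v := by
  have hcd : ∀ y, DifferentiableAt ℝ cut y := fun y ↦ (hcut.differentiable (by simp)) y
  have hzd : ∀ y, DifferentiableAt ℝ z y := fun y ↦ (hz.differentiable (by simp)) y
  have h1 : (fun y ↦ fderiv ℝ (fun y ↦ cut y • z y) y w) = fun y ↦ cut y • fderiv ℝ z y w + fderiv ℝ cut y w • z y := by
    funext y
    rw [fderiv_fun_smul (hcd y) (hzd y)]
    simp [ContinuousLinearMap.smulRight_apply]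
  rw [h1]
  have hG : DifferentiableAt ℝ (fun y ↦ fderiv ℝ z y w) y := (((hz.fderiv_right (m := ∞) (by norm_cast)).clm_apply contDiff_const).differentiable (by simp)) y
  have hH : DifferentiableAt ℝ (fun y ↦ fderiv ℝ cut y w) y := (((hcut.fderiv_right (m := ∞) (by norm_cast)).clm_apply contDiff_const).differentiable (by simp)) y
  have hA : DifferentiableAt ℝ (fun y ↦ cut y • fderiv ℝ z y w) y := (hcd y).smul hG
  have hB : DifferentiableAt ℝ (fun y ↦ fderiv ℝ cut y w • z y) y := hH.smul (hzd y)
  rw [fderiv_fun_add hA hB, fderiv_fun_smul (hcd y) hG, fderiv_fun_smul hH (hzd y)]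
  simp only [FunLike.coe_add, Pi.add_apply, FunLike.coe_smul, Pi.smul_apply, ContinuousLinearMap.smulRight_apply]
  abel

omit [MeasurableSpace E'] [BorelSpace E'] [FiniteDimensional ℝ E'] in
/-- **The cut-off Hessian is the Hessian of the cut-off product up to lower order**:
`cut(y) D²z(y) v w = D²ŵ(y) v w - [(∂_v cut) Dz w + (∂_v∂_w cut) z + (∂_w cut) ∂_v z]`, `ŵ = cut • z`.
[folklore] -/
theorem smul_hess_apply_eq {cut : E' → ℝ} {z : E' → W} (hcut : ContDiff ℝ ∞ cut) (hz : ContDiff ℝ ∞ z) (y v w : E') :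
    cut y • fderiv ℝ (fderiv ℝ z) y v w = fderiv ℝ (fderiv ℝ fun y ↦ cut y • z y) y v w -
      (fderiv ℝ cut y v • fderiv ℝ z y w + fderiv ℝ (fun y ↦ fderiv ℝ cut y w) y v • z y + fderiv ℝ cut y w • fderiv ℝ z y v) := by
  have hŵ : ContDiff ℝ ∞ fun y ↦ cut y • z y := hcut.smul hz
  have hD : DifferentiableAt ℝ (fderiv ℝ fun y ↦ cut y • z y) y := ((hŵ.fderiv_right (m := ∞) (by norm_cast)).differentiable (by simp)) y
  have hDz : DifferentiableAt ℝ (fderiv ℝ z) y := ((hz.fderiv_right (m := ∞) (by norm_cast)).differentiable (by simp)) y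
  have h1 : fderiv ℝ (fderiv ℝ fun y ↦ cut y • z y) y v w = fderiv ℝ (fun y ↦ fderiv ℝ (fun y ↦ cut y • z y) y w) y v := by
    rw [fderiv_clm_apply hD (differentiableAt_const _)]; simp
  have h2 : fderiv ℝ (fderiv ℝ z) y v w = fderiv ℝ (fun y ↦ fderiv ℝ z y w) y v := by
    rw [fderiv_clm_apply hDz (differentiableAt_const _)]; simp
  rw [h1, h2, fderiv_fderiv_smul_apply hcut hz]
  abel

/-- **Energies of first derivatives along a vector**: `E_k(y ↦ Dz(y) w) ≤ ‖w‖² E_{k+1}(z)`. [folklore] -/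
theorem sobolevEnergy_fderiv_apply_le (k : ℕ) {z : E' → W} (hz : ContDiff ℝ ∞ z) (w : E') :
    sobolevEnergy k (fun y ↦ fderiv ℝ z y w) ≤ ENNReal.ofReal (‖w‖ ^ 2) * sobolevEnergy (k + 1) z := by
  classical
  set e := stdOrthonormalBasis ℝ E' with he
  have heq : (fun y ↦ fderiv ℝ z y w) = fun y ↦ ∑ b, ⟪e b, w⟫ • fderiv ℝ z y (e b) := by
    funext y
    conv_lhs => rw [← e.sum_repr' w]
    rw [map_sum]
    exact Finset.sum_congr rfl fun b _ ↦ by rw [map_smul]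
  rw [heq]
  have hf : ∀ b, ContDiff ℝ ∞ fun y ↦ fderiv ℝ z y (e b) := fun b ↦ (hz.fderiv_right (m := ∞) (by norm_cast)).clm_apply contDiff_const
  refine (sobolevEnergy_sum_smul_le _ _ k hf).trans ?_
  have hc : ∑ b, ⟪e b, w⟫ ^ 2 = ‖w‖ ^ 2 := by simpa [real_inner_comm] using e.sum_sq_inner_left w
  rw [hc]
  exact mul_le_mul' le_rfl (sum_sobolevEnergy_fderiv_frame_le k z)

/-- **The energy of the commutator `[D², cut] z (v, w)`** is lower order: with `M` bounding `cut`
and its frame-word derivatives up to order `k + 2`,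
`E_k([D², cut] z (v, w)) ≤ C (M² + 1)(‖v‖ ‖w‖ + ‖v‖ + ‖w‖ + 1)²… ` — stated crudely as
`≤ B E_{k+1}(z)` with `B < ∞` depending on `cut, v, w, k`. [folklore] -/
theorem sobolevEnergy_hessComm_le (k : ℕ) {cut : E' → ℝ} (hcut : ContDiff ℝ ∞ cut) (hcutc : HasCompactSupport cut) (v w : E') :
    ∃ B : ℝ≥0∞, B ≠ ⊤ ∧ ∀ {z : E' → W}, ContDiff ℝ ∞ z →
      sobolevEnergy k (fun y ↦ fderiv ℝ cut y v • fderiv ℝ z y w + fderiv ℝ (fun y ↦ fderiv ℝ cut y w) y v • z y + fderiv ℝ cut y w • fderiv ℝ z y v) ≤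
        B * sobolevEnergy (k + 1) z := by
  obtain ⟨Cs, hCstop, hCs⟩ := sobolevEnergy_smul_le_crude (E := E') (F := W) k
  -- the three multipliers and a common bound of their word derivatives
  have hm1 : ContDiff ℝ ∞ fun y ↦ fderiv ℝ cut y v := (hcut.fderiv_right (m := ∞) (by norm_cast)).clm_apply contDiff_const
  have hm3 : ContDiff ℝ ∞ fun y ↦ fderiv ℝ cut y w := (hcut.fderiv_right (m := ∞) (by norm_cast)).clm_apply contDiff_const
  have hm2 : ContDiff ℝ ∞ fun y ↦ fderiv ℝ (fun y ↦ fderiv ℝ cut y w) y v := (hm3.fderiv_right (m := ∞) (by norm_cast)).clm_apply contDiff_const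
  have hc1 : HasCompactSupport fun y ↦ fderiv ℝ cut y v := hcutc.fderiv_apply (𝕜 := ℝ) v
  have hc3 : HasCompactSupport fun y ↦ fderiv ℝ cut y w := hcutc.fderiv_apply (𝕜 := ℝ) w
  have hc2 : HasCompactSupport fun y ↦ fderiv ℝ (fun y ↦ fderiv ℝ cut y w) y v := hc3.fderiv_apply (𝕜 := ℝ) v
  obtain ⟨M1, hM10, hM1⟩ := exists_forall_norm_iteratedFDeriv_le hm1 hc1 k
  obtain ⟨M2, hM20, hM2⟩ := exists_forall_norm_iteratedFDeriv_le hm2 hc2 k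
  obtain ⟨M3, hM30, hM3⟩ := exists_forall_norm_iteratedFDeriv_le hm3 hc3 k
  set M : ℝ := M1 + M2 + M3 with hM
  -- word bounds from iterated-derivative bounds
  have hwords : ∀ {a : E' → ℝ}, ContDiff ℝ ∞ a → ∀ {Ma : ℝ}, (∀ m ≤ k, ∀ y, ‖iteratedFDeriv ℝ m a y‖ ≤ Ma) → Ma ≤ M →
      (∀ y, |a y| ≤ M) ∧ ∀ l : List (Fin (Module.finrank ℝ E')), l ≠ [] → l.length ≤ k → ∀ y, ‖iterDirDeriv (l.map (stdOrthonormalBasis ℝ E')) a y‖ ≤ M := by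
    intro a ha Ma hMa hMaM
    refine ⟨fun y ↦ ?_, fun l _ hl y ↦ ?_⟩
    · have h := hMa 0 (Nat.zero_le _) y
      rw [norm_iteratedFDeriv_zero, Real.norm_eq_abs] at h
      exact h.trans hMaM
    · have h := norm_iterDirDeriv_le ha (l.map (stdOrthonormalBasis ℝ E')) y
      have hprod : ∏ i, ‖(l.map (stdOrthonormalBasis ℝ E')).get i‖ = 1 := Finset.prod_eq_one fun i _ ↦ by simp [(stdOrthonormalBasis ℝ E').orthonormal.1]
      rw [hprod, mul_one, List.length_map] at h
      exact h.trans ((hMa _ hl y).trans hMaM)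
  obtain ⟨h1a, h1w⟩ := hwords hm1 hM1 (by rw [hM]; linarith)
  obtain ⟨h2a, h2w⟩ := hwords hm2 hM2 (by rw [hM]; linarith)
  obtain ⟨h3a, h3w⟩ := hwords hm3 hM3 (by rw [hM]; linarith)
  refine ⟨4 * (Cs * ENNReal.ofReal (M ^ 2)) * (ENNReal.ofReal (‖w‖ ^ 2) + 1 + ENNReal.ofReal (‖v‖ ^ 2)),
    ENNReal.mul_ne_top (ENNReal.mul_ne_top (by norm_num) (ENNReal.mul_ne_top hCstop ENNReal.ofReal_ne_top))
      (ENNReal.add_ne_top.2 ⟨ENNReal.add_ne_top.2 ⟨ENNReal.ofReal_ne_top, ENNReal.one_ne_top⟩, ENNReal.ofReal_ne_top⟩), fun {z} hz ↦ ?_⟩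
  have hzw : ContDiff ℝ ∞ fun y ↦ fderiv ℝ z y w := (hz.fderiv_right (m := ∞) (by norm_cast)).clm_apply contDiff_const
  have hzv : ContDiff ℝ ∞ fun y ↦ fderiv ℝ z y v := (hz.fderiv_right (m := ∞) (by norm_cast)).clm_apply contDiff_const
  have hT1 : sobolevEnergy k (fun y ↦ fderiv ℝ cut y v • fderiv ℝ z y w) ≤ Cs * ENNReal.ofReal (M ^ 2) * (ENNReal.ofReal (‖w‖ ^ 2) * sobolevEnergy (k + 1) z) :=
    (hCs hm1 hzw h1a h1w).trans (mul_le_mul' le_rfl (sobolevEnergy_fderiv_apply_le k hz w))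
  have hT2 : sobolevEnergy k (fun y ↦ fderiv ℝ (fun y ↦ fderiv ℝ cut y w) y v • z y) ≤ Cs * ENNReal.ofReal (M ^ 2) * (1 * sobolevEnergy (k + 1) z) := by
    refine (hCs hm2 hz h2a h2w).trans (mul_le_mul' le_rfl ?_)
    rw [one_mul]; exact sobolevEnergy_mono (Nat.le_succ k) z
  have hT3 : sobolevEnergy k (fun y ↦ fderiv ℝ cut y w • fderiv ℝ z y v) ≤ Cs * ENNReal.ofReal (M ^ 2) * (ENNReal.ofReal (‖v‖ ^ 2) * sobolevEnergy (k + 1) z) :=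
    (hCs hm3 hzv h3a h3w).trans (mul_le_mul' le_rfl (sobolevEnergy_fderiv_apply_le k hz v))
  have hs1 : ContDiff ℝ k fun y ↦ fderiv ℝ cut y v • fderiv ℝ z y w := (hm1.smul hzw).of_le (by exact_mod_cast le_top)
  have hs2 : ContDiff ℝ k fun y ↦ fderiv ℝ (fun y ↦ fderiv ℝ cut y w) y v • z y := (hm2.smul hz).of_le (by exact_mod_cast le_top)
  have hs3 : ContDiff ℝ k fun y ↦ fderiv ℝ cut y w • fderiv ℝ z y v := (hm3.smul hzv).of_le (by exact_mod_cast le_top)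
  calc _ ≤ 2 * sobolevEnergy k (fun y ↦ fderiv ℝ cut y v • fderiv ℝ z y w + fderiv ℝ (fun y ↦ fderiv ℝ cut y w) y v • z y) +
        2 * sobolevEnergy k (fun y ↦ fderiv ℝ cut y w • fderiv ℝ z y v) := sobolevEnergy_add_le k (hs1.add hs2) hs3
    _ ≤ 2 * (2 * sobolevEnergy k (fun y ↦ fderiv ℝ cut y v • fderiv ℝ z y w) + 2 * sobolevEnergy k (fun y ↦ fderiv ℝ (fun y ↦ fderiv ℝ cut y w) y v • z y)) +
        2 * sobolevEnergy k (fun y ↦ fderiv ℝ cut y w • fderiv ℝ z y v) := add_le_add (mul_le_mul' le_rfl (sobolevEnergy_add_le k hs1 hs2)) le_rfl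
    _ ≤ 2 * (2 * (Cs * ENNReal.ofReal (M ^ 2) * (ENNReal.ofReal (‖w‖ ^ 2) * sobolevEnergy (k + 1) z)) +
          2 * (Cs * ENNReal.ofReal (M ^ 2) * (1 * sobolevEnergy (k + 1) z))) +
        2 * (Cs * ENNReal.ofReal (M ^ 2) * (ENNReal.ofReal (‖v‖ ^ 2) * sobolevEnergy (k + 1) z)) :=
        add_le_add (mul_le_mul' le_rfl (add_le_add (mul_le_mul' le_rfl hT1) (mul_le_mul' le_rfl hT2))) (mul_le_mul' le_rfl hT3)
    _ ≤ 4 * (Cs * ENNReal.ofReal (M ^ 2)) * (ENNReal.ofReal (‖w‖ ^ 2) + 1 + ENNReal.ofReal (‖v‖ ^ 2)) * sobolevEnergy (k + 1) z := by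
        rw [one_mul]
        have h : 2 * (Cs * ENNReal.ofReal (M ^ 2) * (ENNReal.ofReal (‖v‖ ^ 2) * sobolevEnergy (k + 1) z)) ≤
            4 * (Cs * ENNReal.ofReal (M ^ 2) * (ENNReal.ofReal (‖v‖ ^ 2) * sobolevEnergy (k + 1) z)) := mul_le_mul' (by norm_num) le_rfl
        calc _ ≤ 2 * (2 * (Cs * ENNReal.ofReal (M ^ 2) * (ENNReal.ofReal (‖w‖ ^ 2) * sobolevEnergy (k + 1) z)) +
              2 * (Cs * ENNReal.ofReal (M ^ 2) * sobolevEnergy (k + 1) z)) + 4 * (Cs * ENNReal.ofReal (M ^ 2) * (ENNReal.ofReal (‖v‖ ^ 2) * sobolevEnergy (k + 1) z)) :=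
              add_le_add le_rfl h
          _ = _ := by ring

/-! ### The sharp flat estimate (boundedness form) -/

section Theta

variable [FiniteDimensional ℝ W] {ι : Type*} [Fintype ι]

/-- The frame sum of second-derivative energies `Σ_{ab} E_K(∂_a ∂_b ŵ)` (the top-order part of the
maximal-regularity quantity). [folklore] -/
def hessEnergy (K : ℕ) (ŵ : E' → W) : ℝ≥0∞ :=
  ∑ a, ∑ b, sobolevEnergy K (fun y ↦ fderiv ℝ (fun x ↦ fderiv ℝ ŵ x (stdOrthonormalBasis ℝ E' b)) y (stdOrthonormalBasis ℝ E' a))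

omit [FiniteDimensional ℝ W] in
/-- `hessEnergy_eq`: unfolding. [folklore] -/
theorem hessEnergy_eq (K : ℕ) (ŵ : E' → W) : hessEnergy K ŵ =
    ∑ a, ∑ b, sobolevEnergy K (fun y ↦ fderiv ℝ (fun x ↦ fderiv ℝ ŵ x (stdOrthonormalBasis ℝ E' b)) y (stdOrthonormalBasis ℝ E' a)) := rfl

set_option maxHeartbeats 1600000 in
/-- **The sharp flat energy estimate (boundedness form).** For the data of the flat Picard source
and every order `K`, for every `R` there is `B < ∞` such that for every smooth compactly
supported `z` with `‖Dᵐ z‖ ≤ R` (`m ≤ K/2 + 3`) and every `0 ≤ δ ≤ 1` bounding `|Gᶜᵢᵢ'(y, 𝔷 y)|`: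
`E_K(Θ♭(z)) ≤ 16 |ι|⁴ A⁴ δ² Σ_{ab} E_K(∂_a ∂_b (cut • z)) + B (1 + E_{K+1}(z))`, `A = Σᵢ ‖Avᵢ‖`;
the top constant does not depend on `K`. [cite: TaylorPDEIII2011, Ch. 15, §7] -/
theorem energy_thetaFlat_le_sharp (Av : ι → E') (K : ℕ) {cut : E' → ℝ} (hcut : ContDiff ℝ ∞ cut) (hcutc : HasCompactSupport cut)
    {Gc : ι → ι → (E' × (W × (E' →L[ℝ] W)) → ℝ)} (hGc : ∀ i i', ContDiff ℝ ∞ (Gc i i')) (hGcc : ∀ i i', HasCompactSupport (Gc i i'))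
    {Gr : E' × (W × (E' →L[ℝ] W)) → W} (hGr : ContDiff ℝ ∞ Gr) (hGrc : HasCompactSupport Gr) {g₀ : E' → W} (hg₀ : ContDiff ℝ ∞ g₀) (hg₀c : HasCompactSupport g₀)
    (R : ℝ) : ∃ B : ℝ≥0∞, B ≠ ⊤ ∧ ∀ {z : E' → W}, ContDiff ℝ ∞ z → HasCompactSupport z →
      (∀ m ≤ K / 2 + 3, ∀ y, ‖iteratedFDeriv ℝ m z y‖ ≤ R) → ∀ {δ : ℝ}, 0 ≤ δ → δ ≤ 1 → (∀ i i' y, |Gc i i' (y, jetOf z y)| ≤ δ) →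
      sobolevEnergy K (thetaFlat Av cut Gc Gr g₀ z) ≤
        ENNReal.ofReal (16 * (Fintype.card ι : ℝ) ^ 4 * (∑ i, ‖Av i‖) ^ 4 * δ ^ 2) * hessEnergy K (fun y ↦ cut y • z y) +
          B * (1 + sobolevEnergy (K + 1) z) := by
  classical
  /- ## constants -/
  obtain ⟨Mcut, hMcut0, hMcut⟩ := exists_forall_norm_iteratedFDeriv_le hcut hcutc K
  obtain ⟨Ccut, hCcuttop, hCcut⟩ := sobolevEnergy_smul_le_crude (E := E') (F := W) K
  obtain ⟨CcutK1, hCcutK1top, hCcutK1⟩ := sobolevEnergy_smul_le_crude (E := E') (F := W) (K - 1)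
  obtain ⟨CA', hCA'top, hCA'⟩ := sobolevEnergy_hessComp_le (E' := E') (W := W) (K - 1)
  obtain ⟨Chl, hChltop, hChl⟩ := sobolevEnergy_bilinear_highlow_sharp (E := E') (G₁ := ℝ) (G₂ := W) (F := W) K (ε := 1) one_pos le_rfl
  obtain ⟨Cf, hCftop, hCf⟩ := sobolevEnergy_fderiv_le (E' := E') (V := W) K
  have hcomm := fun i i' ↦ sobolevEnergy_hessComm_le (W := W) K hcut hcutc (Av i) (Av i')
  choose Bc hBctop hBc using hcomm
  set Amax : ℝ := ∑ i, ‖Av i‖ with hAmax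
  have hAmax0 : 0 ≤ Amax := Finset.sum_nonneg fun i _ ↦ norm_nonneg _
  have hAi : ∀ i, ‖Av i‖ ≤ Amax := fun i ↦ Finset.single_le_sum (f := fun i ↦ ‖Av i‖) (fun _ _ ↦ norm_nonneg _) (Finset.mem_univ i)
  set cι : ℝ≥0∞ := (Fintype.card ι : ℝ≥0∞) with hcι
  set h : ℕ := K / 2 + 1 with hh
  have ha := fun i i' ↦ norm_iteratedFDeriv_jetComp_le (K / 2) (hGc i i') (hGcc i i') (|R| + |R|)
  choose Ca hCa0 hCa using ha
  set Camax : ℝ := ∑ i, ∑ i', Ca i i' with hCamax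
  have hCamax0 : 0 ≤ Camax := Finset.sum_nonneg fun i _ ↦ Finset.sum_nonneg fun i' _ ↦ hCa0 i i'
  have hCai : ∀ i i', Ca i i' ≤ Camax := fun i i' ↦ (Finset.single_le_sum (f := fun i' ↦ Ca i i') (fun _ _ ↦ hCa0 i _) (Finset.mem_univ i')).trans
    (Finset.single_le_sum (f := fun i ↦ ∑ i', Ca i i') (fun _ _ ↦ Finset.sum_nonneg fun _ _ ↦ hCa0 _ _) (Finset.mem_univ i))
  have hc := fun i i' ↦ sobolevEnergy_jetComp_le K (hGc i i') (hGcc i i') (|R| + |R|)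
  choose Cc hCctop hCc using hc
  obtain ⟨Cr, hCrtop, hCr⟩ := sobolevEnergy_jetComp_le K hGr hGrc (|R| + |R|)
  set Ccmax : ℝ≥0∞ := ∑ i, ∑ i', Cc i i' with hCcmax
  have hCcmaxtop : Ccmax ≠ ⊤ := ENNReal.sum_ne_top.2 fun i _ ↦ ENNReal.sum_ne_top.2 fun i' _ ↦ hCctop i i'
  have hCci : ∀ i i', Cc i i' ≤ Ccmax := fun i i' ↦ (Finset.single_le_sum (f := fun i' ↦ Cc i i') (fun _ _ ↦ bot_le) (Finset.mem_univ i')).trans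
    (Finset.single_le_sum (f := fun i ↦ ∑ i', Cc i i') (fun _ _ ↦ bot_le) (Finset.mem_univ i))
  set Bcmax : ℝ≥0∞ := ∑ i, ∑ i', Bc i i' with hBcmax
  have hBcmaxtop : Bcmax ≠ ⊤ := ENNReal.sum_ne_top.2 fun i _ ↦ ENNReal.sum_ne_top.2 fun i' _ ↦ hBctop i i'
  have hBci : ∀ i i', Bc i i' ≤ Bcmax := fun i i' ↦ (Finset.single_le_sum (f := fun i' ↦ Bc i i') (fun _ _ ↦ bot_le) (Finset.mem_univ i')).trans
    (Finset.single_le_sum (f := fun i ↦ ∑ i', Bc i i') (fun _ _ ↦ bot_le) (Finset.mem_univ i))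
  -- the sup bound of the low derivatives of `ψ = cut • D²z(Av, Av')`
  set Nψ : ℝ := 2 ^ K * Mcut * (Amax * Amax * |R|) with hNψ
  have hNψ0 : 0 ≤ Nψ := by positivity
  set Slow : ℝ≥0∞ := ((K + 1 : ℕ) : ℝ≥0∞) * (1 + Cf) with hSlow
  have hSlowtop : Slow ≠ ⊤ := ENNReal.mul_ne_top (ENNReal.natCast_ne_top _) (ENNReal.add_ne_top.2 ⟨ENNReal.one_ne_top, hCftop⟩)
  -- lower-order part of the product terms
  set Blow : ℝ≥0∞ := CcutK1 * ENNReal.ofReal (Mcut ^ 2) * (CA' * ENNReal.ofReal ((Amax * Amax) ^ 2)) with hBlow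
  have hBlowtop : Blow ≠ ⊤ := ENNReal.mul_ne_top (ENNReal.mul_ne_top hCcutK1top ENNReal.ofReal_ne_top) (ENNReal.mul_ne_top hCA'top ENNReal.ofReal_ne_top)
  set Bpair : ℝ≥0∞ := 4 * Bcmax + Chl * ((h : ℝ≥0∞) * ENNReal.ofReal (Camax ^ 2) * Blow +
    ENNReal.ofReal (Nψ ^ 2) * ((K + 1 : ℕ) : ℝ≥0∞) * Ccmax * (1 + Slow)) with hBpair
  have hBpairtop : Bpair ≠ ⊤ := ENNReal.add_ne_top.2 ⟨ENNReal.mul_ne_top (by norm_num) hBcmaxtop, ENNReal.mul_ne_top hChltop (ENNReal.add_ne_top.2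
    ⟨ENNReal.mul_ne_top (ENNReal.mul_ne_top (ENNReal.natCast_ne_top _) ENNReal.ofReal_ne_top) hBlowtop,
     ENNReal.mul_ne_top (ENNReal.mul_ne_top (ENNReal.mul_ne_top ENNReal.ofReal_ne_top (ENNReal.natCast_ne_top _)) hCcmaxtop)
      (ENNReal.add_ne_top.2 ⟨ENNReal.one_ne_top, hSlowtop⟩)⟩)⟩
  have hg₀E : sobolevEnergy K g₀ ≠ ⊤ := sobolevEnergy_ne_top_of_hasCompactSupport hg₀ hg₀c K
  set B : ℝ≥0∞ := 4 * (cι * cι * (cι * cι)) * Bpair + 4 * (Ccut * ENNReal.ofReal (Mcut ^ 2) * (Cr * (1 + Slow))) + 2 * sobolevEnergy K g₀ with hB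
  refine ⟨B, ?_, fun {z} hz hzc hR δ hδ0 hδ1 hδ ↦ ?_⟩
  · exact ENNReal.add_ne_top.2 ⟨ENNReal.add_ne_top.2 ⟨ENNReal.mul_ne_top (ENNReal.mul_ne_top (by norm_num) (ENNReal.mul_ne_top
      (ENNReal.mul_ne_top (ENNReal.natCast_ne_top _) (ENNReal.natCast_ne_top _)) (ENNReal.mul_ne_top (ENNReal.natCast_ne_top _) (ENNReal.natCast_ne_top _)))) hBpairtop,
      ENNReal.mul_ne_top (by norm_num) (ENNReal.mul_ne_top (ENNReal.mul_ne_top hCcuttop ENNReal.ofReal_ne_top)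
        (ENNReal.mul_ne_top hCrtop (ENNReal.add_ne_top.2 ⟨ENNReal.one_ne_top, hSlowtop⟩)))⟩, ENNReal.mul_ne_top (by simp) hg₀E⟩
  /- ## the pieces -/
  obtain ⟨𝔷, h𝔷⟩ : ∃ 𝔷 : E' → W × (E' →L[ℝ] W), 𝔷 = jetOf z := ⟨_, rfl⟩
  have h𝔷s : ContDiff ℝ ∞ 𝔷 := by rw [h𝔷]; exact contDiff_jetOf hz
  have hD : ContDiff ℝ ∞ (fderiv ℝ z) := hz.fderiv_right (m := ∞) (by norm_cast)
  have hDD : ContDiff ℝ ∞ (fderiv ℝ (fderiv ℝ z)) := hD.fderiv_right (m := ∞) (by norm_cast)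
  obtain ⟨ŵ, hŵ⟩ : ∃ ŵ : E' → W, ŵ = fun y ↦ cut y • z y := ⟨_, rfl⟩
  rw [← hŵ]
  have hŵs : ContDiff ℝ ∞ ŵ := by rw [hŵ]; exact hcut.smul hz
  have h𝔷b : ∀ m ≤ K / 2 + 2, ∀ y, ‖iteratedFDeriv ℝ m 𝔷 y‖ ≤ |R| + |R| := by
    intro m hm y
    rw [h𝔷]
    refine (norm_iteratedFDeriv_jetOf_le hz m y).trans (add_le_add ?_ ?_)
    · exact (hR m (by omega) y).trans (le_abs_self R)
    · exact (hR (m + 1) (by omega) y).trans (le_abs_self R)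
  set X1 := sobolevEnergy (K + 1) z with hX1
  set HS := hessEnergy K ŵ with hHS
  have hzK : sobolevEnergy K z ≤ X1 := sobolevEnergy_mono (Nat.le_succ K) z
  have hDz : sobolevEnergy K (fderiv ℝ z) ≤ Cf * X1 := hCf hz
  have h𝔷E : ∀ i ≤ K, ∑ m ∈ Finset.range (i + 1), sobolevEnergy m 𝔷 ≤ Slow * X1 := by
    intro i hi
    calc _ ≤ ∑ _m ∈ Finset.range (i + 1), (sobolevEnergy K z + sobolevEnergy K (fderiv ℝ z)) := by
          refine Finset.sum_le_sum fun m hm ↦ ?_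
          have hm' : m ≤ K := (Nat.lt_succ_iff.1 (Finset.mem_range.1 hm)).trans hi
          rw [h𝔷]
          exact (sobolevEnergy_jetOf_le m hz).trans (add_le_add (sobolevEnergy_mono hm' _) (sobolevEnergy_mono hm' _))
      _ ≤ ((K + 1 : ℕ) : ℝ≥0∞) * (sobolevEnergy K z + sobolevEnergy K (fderiv ℝ z)) := by
          rw [Finset.sum_const, Finset.card_range, nsmul_eq_mul]
          exact mul_le_mul' (by exact_mod_cast (show i + 1 ≤ K + 1 by omega)) le_rfl
      _ ≤ ((K + 1 : ℕ) : ℝ≥0∞) * (X1 + Cf * X1) := mul_le_mul' le_rfl (add_le_add hzK hDz)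
      _ = Slow * X1 := by rw [hSlow]; ring
  -- the cut-off Hessian components `ψ = cut • D²z(Av, Av')`
  obtain ⟨ψ, hψ⟩ : ∃ ψ : ι → ι → E' → W, ψ = fun i i' y ↦ cut y • fderiv ℝ (fderiv ℝ z) y (Av i) (Av i') := ⟨_, rfl⟩
  have hψ0s : ∀ i i', ContDiff ℝ ∞ fun y ↦ fderiv ℝ (fderiv ℝ z) y (Av i) (Av i') := fun i i' ↦ (hDD.clm_apply contDiff_const).clm_apply contDiff_const
  have hψs : ∀ i i', ContDiff ℝ ∞ (ψ i i') := fun i i' ↦ by rw [hψ]; exact hcut.smul (hψ0s i i')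
  have hA4 : ∀ i i', ENNReal.ofReal ((‖Av i‖ * ‖Av i'‖) ^ 2) ≤ ENNReal.ofReal ((Amax * Amax) ^ 2) := fun i i' ↦
    ENNReal.ofReal_le_ofReal (pow_le_pow_left₀ (by positivity) (mul_le_mul (hAi i) (hAi i') (norm_nonneg _) hAmax0) 2)
  -- TOP: `E_K(ψ) ≤ 2 A⁴ HS + 2 Bc X1` (same chart)
  have hψK : ∀ i i', sobolevEnergy K (ψ i i') ≤ 2 * (ENNReal.ofReal ((Amax * Amax) ^ 2) * HS) + 2 * (Bcmax * X1) := by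
    intro i i'
    have heq : ψ i i' = fun y ↦ fderiv ℝ (fderiv ℝ ŵ) y (Av i) (Av i') +
        -(fderiv ℝ cut y (Av i) • fderiv ℝ z y (Av i') + fderiv ℝ (fun y ↦ fderiv ℝ cut y (Av i')) y (Av i) • z y + fderiv ℝ cut y (Av i') • fderiv ℝ z y (Av i)) := by
      rw [hψ]; funext y
      show cut y • fderiv ℝ (fderiv ℝ z) y (Av i) (Av i') = _
      rw [smul_hess_apply_eq hcut hz y (Av i) (Av i'), hŵ, sub_eq_add_neg]
    rw [heq]
    have hs1 : ContDiff ℝ K fun y ↦ fderiv ℝ (fderiv ℝ ŵ) y (Av i) (Av i') :=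
      ((((hŵs.fderiv_right (m := ∞) (by norm_cast)).fderiv_right (m := ∞) (by norm_cast)).clm_apply contDiff_const).clm_apply contDiff_const).of_le
        (by exact_mod_cast le_top)
    have hm1 : ContDiff ℝ ∞ fun y ↦ fderiv ℝ cut y (Av i) := (hcut.fderiv_right (m := ∞) (by norm_cast)).clm_apply contDiff_const
    have hm3 : ContDiff ℝ ∞ fun y ↦ fderiv ℝ cut y (Av i') := (hcut.fderiv_right (m := ∞) (by norm_cast)).clm_apply contDiff_const
    have hm2 : ContDiff ℝ ∞ fun y ↦ fderiv ℝ (fun y ↦ fderiv ℝ cut y (Av i')) y (Av i) := (hm3.fderiv_right (m := ∞) (by norm_cast)).clm_apply contDiff_const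
    have hRs : ContDiff ℝ ∞ fun y ↦ fderiv ℝ cut y (Av i) • fderiv ℝ z y (Av i') + fderiv ℝ (fun y ↦ fderiv ℝ cut y (Av i')) y (Av i) • z y +
        fderiv ℝ cut y (Av i') • fderiv ℝ z y (Av i) :=
      ((hm1.smul (hD.clm_apply contDiff_const)).add (hm2.smul hz)).add (hm3.smul (hD.clm_apply contDiff_const))
    refine (sobolevEnergy_add_le K hs1 (hRs.neg.of_le (by exact_mod_cast le_top))).trans (add_le_add (mul_le_mul' le_rfl ?_) (mul_le_mul' le_rfl ?_))
    · refine (sobolevEnergy_hess_apply_le K hŵs (Av i) (Av i')).trans ?_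
      rw [hHS, hessEnergy_eq]
      exact mul_le_mul' (hA4 i i') le_rfl
    · rw [sobolevEnergy_neg K (hRs.of_le (by exact_mod_cast le_top))]
      exact (hBc i i' hz).trans (mul_le_mul' (hBci i i') le_rfl)
  -- LOW: `E_{K-j}(ψ) ≤ Blow X1` for `1 ≤ j < h`
  have hcutb : ∀ y, |cut y| ≤ Mcut := fun y ↦ by
    have h := hMcut 0 (Nat.zero_le _) y
    rwa [norm_iteratedFDeriv_zero, Real.norm_eq_abs] at h
  have hcutw : ∀ k ≤ K, ∀ l : List (Fin (Module.finrank ℝ E')), l ≠ [] → l.length ≤ k → ∀ y, ‖iterDirDeriv (l.map (stdOrthonormalBasis ℝ E')) cut y‖ ≤ Mcut := by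
    intro k hk l _ hl y
    have h := norm_iterDirDeriv_le hcut (l.map (stdOrthonormalBasis ℝ E')) y
    have hprod : ∏ i, ‖(l.map (stdOrthonormalBasis ℝ E')).get i‖ = 1 := Finset.prod_eq_one fun i _ ↦ by simp [(stdOrthonormalBasis ℝ E').orthonormal.1]
    rw [hprod, mul_one, List.length_map] at h
    exact h.trans (hMcut _ (hl.trans hk) y)
  have hψlow : ∀ i i', ∀ j, 1 ≤ j → j < h → sobolevEnergy (K - j) (ψ i i') ≤ Blow * X1 := by
    intro i i' j hj1 hjh
    have hK2 : 2 ≤ K := by simp only [hh] at hjh; omega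
    have h1 : sobolevEnergy (K - j) (ψ i i') ≤ sobolevEnergy (K - 1) (ψ i i') := sobolevEnergy_mono (by omega) _
    refine h1.trans ?_
    rw [hψ]
    refine (hCcutK1 hcut (hψ0s i i') hcutb (hcutw (K - 1) (by omega))).trans ?_
    calc CcutK1 * ENNReal.ofReal (Mcut ^ 2) * sobolevEnergy (K - 1) (fun y ↦ fderiv ℝ (fderiv ℝ z) y (Av i) (Av i'))
        ≤ CcutK1 * ENNReal.ofReal (Mcut ^ 2) * (CA' * ENNReal.ofReal ((‖Av i‖ * ‖Av i'‖) ^ 2) * sobolevEnergy (K - 1 + 2) z) := mul_le_mul' le_rfl (hCA' hz _ _)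
      _ ≤ CcutK1 * ENNReal.ofReal (Mcut ^ 2) * (CA' * ENNReal.ofReal ((Amax * Amax) ^ 2) * X1) := by
          rw [show K - 1 + 2 = K + 1 by omega]
          exact mul_le_mul' le_rfl (mul_le_mul' (mul_le_mul' le_rfl (hA4 i i')) le_rfl)
      _ = Blow * X1 := by rw [hBlow]; ring
  -- sup bounds of the low derivatives of `ψ`
  have hψN : ∀ i i', ∀ m, m + h ≤ K → ∀ y, ‖iteratedFDeriv ℝ m (ψ i i') y‖ ≤ Nψ := by
    intro i i' m hm y
    have hmK : m ≤ K := by omega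
    rw [hψ]
    refine (norm_iteratedFDeriv_smul_le hcut (hψ0s i i') y (n := m) (by exact_mod_cast le_top)).trans ?_
    have hterm : ∀ l ∈ Finset.range (m + 1), (m.choose l : ℝ) * ‖iteratedFDeriv ℝ l cut y‖ * ‖iteratedFDeriv ℝ (m - l) (fun y ↦ fderiv ℝ (fderiv ℝ z) y (Av i) (Av i')) y‖ ≤
        (m.choose l : ℝ) * Mcut * (Amax * Amax * |R|) := by
      intro l hl
      have hl' : l ≤ m := Nat.lt_succ_iff.1 (Finset.mem_range.1 hl)
      obtain ⟨r, hr⟩ : ∃ r : ℕ, r = m - l := ⟨_, rfl⟩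
      rw [← hr]
      have h1 := norm_iteratedFDeriv_clm_apply_const (f := fun y ↦ fderiv ℝ (fderiv ℝ z) y (Av i)) (c := Av i') (x := y) (N := ∞) (n := r)
        ((hDD.clm_apply contDiff_const).contDiffAt) (by exact_mod_cast le_top)
      have h2 := norm_iteratedFDeriv_clm_apply_const (f := fderiv ℝ (fderiv ℝ z)) (c := Av i) (x := y) (N := ∞) (n := r)
        hDD.contDiffAt (by exact_mod_cast le_top)
      have h3 : ‖iteratedFDeriv ℝ r (fderiv ℝ (fderiv ℝ z)) y‖ ≤ |R| := by
        rw [norm_iteratedFDeriv_fderiv, norm_iteratedFDeriv_fderiv]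
        exact (hR (r + 1 + 1) (by simp only [hh] at hm; omega) y).trans (le_abs_self R)
      have h4 : ‖iteratedFDeriv ℝ r (fun y ↦ fderiv ℝ (fderiv ℝ z) y (Av i) (Av i')) y‖ ≤ Amax * Amax * |R| :=
        calc _ ≤ ‖Av i'‖ * ‖iteratedFDeriv ℝ r (fun y ↦ fderiv ℝ (fderiv ℝ z) y (Av i)) y‖ := h1
          _ ≤ ‖Av i'‖ * (‖Av i‖ * ‖iteratedFDeriv ℝ r (fderiv ℝ (fderiv ℝ z)) y‖) := mul_le_mul_of_nonneg_left h2 (norm_nonneg _)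
          _ ≤ Amax * (Amax * |R|) := mul_le_mul (hAi i') (mul_le_mul (hAi i) h3 (norm_nonneg _) hAmax0) (by positivity) hAmax0
          _ = Amax * Amax * |R| := by ring
      exact mul_le_mul (mul_le_mul_of_nonneg_left (hMcut l (hl'.trans hmK) y) (Nat.cast_nonneg _)) h4 (norm_nonneg _) (by positivity)
    refine (Finset.sum_le_sum hterm).trans ?_
    rw [← Finset.sum_mul, ← Finset.sum_mul]
    have h' : ∑ l ∈ Finset.range (m + 1), (m.choose l : ℝ) = 2 ^ m := by exact_mod_cast Nat.sum_range_choose m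
    rw [h', hNψ]
    have h2 : (2 : ℝ) ^ m ≤ 2 ^ K := pow_le_pow_right₀ (by norm_num) hmK
    have : 0 ≤ Mcut * (Amax * Amax * |R|) := by positivity
    nlinarith
  -- the coefficient composites
  obtain ⟨φ, hφ⟩ : ∃ φ : ι → ι → E' → ℝ, φ = fun i i' ↦ jetComp (Gc i i') 𝔷 := ⟨_, rfl⟩
  have hφs : ∀ i i', ContDiff ℝ ∞ (φ i i') := fun i i' ↦ by rw [hφ]; exact contDiff_jetComp (hGc i i') h𝔷s
  obtain ⟨Mφ, hMφ⟩ : ∃ Mφ : ℕ → ℝ, Mφ = fun j ↦ if j = 0 then δ else Camax := ⟨_, rfl⟩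
  have hMφ0 : Mφ 0 = δ := by simp [hMφ]
  have hφM : ∀ i i', ∀ j < h, ∀ y, ‖iteratedFDeriv ℝ j (φ i i') y‖ ≤ Mφ j := by
    intro i i' j hj y
    rcases Nat.eq_zero_or_pos j with rfl | hjpos
    · rw [hMφ0, norm_iteratedFDeriv_zero, Real.norm_eq_abs, hφ, h𝔷]
      exact hδ i i' y
    · rw [show Mφ j = Camax by simp [hMφ, hjpos.ne'], hφ]
      exact (hCa i i' h𝔷s (fun m hm y ↦ h𝔷b m (by simp only [hh] at hj; omega) y) j (by simp only [hh] at hj; omega) y).trans (hCai i i')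
  have hφE : ∀ i i', ∀ j ≤ K, sobolevEnergy j (φ i i') ≤ Ccmax * (1 + Slow * X1) := by
    intro i i' j hj
    rw [hφ]
    refine (hCc i i' h𝔷s (fun m hm y ↦ h𝔷b m (by omega) y) j hj).trans ?_
    exact mul_le_mul' (hCci i i') (add_le_add le_rfl (h𝔷E j hj))
  /- ## the product terms by the sharp high–low bound -/
  obtain ⟨Bs, hBs⟩ : ∃ Bs : ℝ →L[ℝ] W →L[ℝ] W, Bs = ContinuousLinearMap.lsmul ℝ ℝ := ⟨_, rfl⟩
  have hBsapp : ∀ (r : ℝ) (x : W), Bs r x = r • x := fun r x ↦ by rw [hBs]; rfl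
  have hBsn : ‖Bs‖ ≤ 1 := by rw [hBs]; exact ContinuousLinearMap.opNorm_lsmul_le
  have hh1 : 1 ≤ h := by simp [hh]
  have hhK : h ≤ K + 1 := by simp only [hh]; omega
  have hδsq : ENNReal.ofReal (δ ^ 2) ≤ 1 := by
    rw [← ENNReal.ofReal_one]; exact ENNReal.ofReal_le_ofReal (by nlinarith)
  have hprod : ∀ i i', sobolevEnergy K (fun y ↦ φ i i' y • ψ i i' y) ≤
      4 * ENNReal.ofReal ((Amax * Amax) ^ 2) * ENNReal.ofReal (δ ^ 2) * HS + Bpair * (1 + X1) := by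
    intro i i'
    have hfun : (fun y ↦ φ i i' y • ψ i i' y) = fun y ↦ Bs (φ i i' y) (ψ i i' y) := by funext y; rw [hBsapp]
    rw [hfun]
    have hsharp := hChl Bs (hφs i i') (hψs i i') hh1 hhK (Mφ := Mφ) (hφM i i') hNψ0 (hψN i i')
    rw [highLowQ'_eq, hMφ0] at hsharp
    refine hsharp.trans ?_
    -- top term: `2 δ² E_K(ψ) ≤ 4 A⁴ δ² HS + 4 Bc X1`
    have h1 : ENNReal.ofReal ((1 + 1) * (‖Bs‖ * δ) ^ 2) ≤ 2 * ENNReal.ofReal (δ ^ 2) := by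
      rw [← ENNReal.ofReal_ofNat, ← ENNReal.ofReal_mul (by norm_num)]
      refine ENNReal.ofReal_le_ofReal ?_
      have h2 : (‖Bs‖ * δ) ^ 2 ≤ δ ^ 2 := by rw [mul_pow]; exact mul_le_of_le_one_left (sq_nonneg _) (by nlinarith [norm_nonneg Bs])
      nlinarith
    have htop : ENNReal.ofReal ((1 + 1) * (‖Bs‖ * δ) ^ 2) * sobolevEnergy K (ψ i i') ≤
        4 * ENNReal.ofReal ((Amax * Amax) ^ 2) * ENNReal.ofReal (δ ^ 2) * HS + 4 * (Bcmax * X1) := by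
      refine (mul_le_mul' h1 (hψK i i')).trans ?_
      rw [mul_add]
      refine add_le_add (le_of_eq (by ring)) ?_
      calc 2 * ENNReal.ofReal (δ ^ 2) * (2 * (Bcmax * X1)) ≤ 2 * 1 * (2 * (Bcmax * X1)) := mul_le_mul' (mul_le_mul' le_rfl hδsq) le_rfl
        _ = 4 * (Bcmax * X1) := by ring
    -- the rest
    have hB1 : ENNReal.ofReal (‖Bs‖ ^ 2) ≤ 1 := by rw [← ENNReal.ofReal_one]; exact ENNReal.ofReal_le_ofReal (by nlinarith [norm_nonneg Bs])
    have hsup : ∑ j ∈ Finset.Ico 1 h, ENNReal.ofReal (Mφ j ^ 2) * sobolevEnergy (K - j) (ψ i i') ≤ (h : ℝ≥0∞) * ENNReal.ofReal (Camax ^ 2) * Blow * X1 := by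
      calc _ ≤ ∑ _j ∈ Finset.Ico 1 h, ENNReal.ofReal (Camax ^ 2) * (Blow * X1) := by
            refine Finset.sum_le_sum fun j hj ↦ ?_
            obtain ⟨hj1, hjh⟩ := Finset.mem_Ico.1 hj
            rw [show Mφ j = Camax by simp [hMφ, (show j ≠ 0 by omega)]]
            exact mul_le_mul' le_rfl (hψlow i i' j hj1 hjh)
        _ ≤ (h : ℝ≥0∞) * (ENNReal.ofReal (Camax ^ 2) * (Blow * X1)) := by
            rw [Finset.sum_const, nsmul_eq_mul, Nat.card_Ico]
            exact mul_le_mul' (by exact_mod_cast Nat.sub_le h 1) le_rfl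
        _ = _ := by ring
    have hL2 : ENNReal.ofReal (Nψ ^ 2) * ∑ j ∈ Finset.Ico h (K + 1), sobolevEnergy j (φ i i') ≤
        ENNReal.ofReal (Nψ ^ 2) * ((K + 1 : ℕ) : ℝ≥0∞) * Ccmax * (1 + Slow) * (1 + X1) := by
      calc _ ≤ ENNReal.ofReal (Nψ ^ 2) * ∑ _j ∈ Finset.Ico h (K + 1), Ccmax * (1 + Slow * X1) :=
            mul_le_mul' le_rfl (Finset.sum_le_sum fun j hj ↦ hφE i i' j (Nat.lt_succ_iff.1 (Finset.mem_Ico.1 hj).2))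
        _ ≤ ENNReal.ofReal (Nψ ^ 2) * (((K + 1 : ℕ) : ℝ≥0∞) * (Ccmax * (1 + Slow * X1))) := by
            rw [Finset.sum_const, nsmul_eq_mul, Nat.card_Ico]
            exact mul_le_mul' le_rfl (mul_le_mul' (by exact_mod_cast (show K + 1 - h ≤ K + 1 by omega)) le_rfl)
        _ ≤ ENNReal.ofReal (Nψ ^ 2) * (((K + 1 : ℕ) : ℝ≥0∞) * (Ccmax * ((1 + Slow) * (1 + X1)))) := by
            gcongr
            calc 1 + Slow * X1 ≤ 1 + Slow * X1 + (X1 + Slow) := le_self_add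
              _ = (1 + Slow) * (1 + X1) := by ring
        _ = _ := by ring
    calc ENNReal.ofReal ((1 + 1) * (‖Bs‖ * δ) ^ 2) * sobolevEnergy K (ψ i i') +
          Chl * ENNReal.ofReal (‖Bs‖ ^ 2) * ((∑ j ∈ Finset.Ico 1 h, ENNReal.ofReal (Mφ j ^ 2) * sobolevEnergy (K - j) (ψ i i')) +
            ENNReal.ofReal (Nψ ^ 2) * ∑ j ∈ Finset.Ico h (K + 1), sobolevEnergy j (φ i i'))
        ≤ (4 * ENNReal.ofReal ((Amax * Amax) ^ 2) * ENNReal.ofReal (δ ^ 2) * HS + 4 * (Bcmax * X1)) +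
          Chl * 1 * ((h : ℝ≥0∞) * ENNReal.ofReal (Camax ^ 2) * Blow * X1 + ENNReal.ofReal (Nψ ^ 2) * ((K + 1 : ℕ) : ℝ≥0∞) * Ccmax * (1 + Slow) * (1 + X1)) :=
          add_le_add htop (mul_le_mul' (mul_le_mul' le_rfl hB1) (add_le_add hsup hL2))
      _ ≤ (4 * ENNReal.ofReal ((Amax * Amax) ^ 2) * ENNReal.ofReal (δ ^ 2) * HS + 4 * (Bcmax * (1 + X1))) +
          Chl * 1 * ((h : ℝ≥0∞) * ENNReal.ofReal (Camax ^ 2) * Blow * (1 + X1) + ENNReal.ofReal (Nψ ^ 2) * ((K + 1 : ℕ) : ℝ≥0∞) * Ccmax * (1 + Slow) * (1 + X1)) := by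
          gcongr <;> exact le_add_self
      _ = _ := by rw [hBpair]; ring
  /- ## assembly -/
  obtain ⟨T, hT⟩ : ∃ T : E' → W, T = fun y ↦ ∑ i, ∑ i', φ i i' y • ψ i i' y := ⟨_, rfl⟩
  have hTs : ContDiff ℝ ∞ T := by rw [hT]; exact ContDiff.sum fun i _ ↦ ContDiff.sum fun i' _ ↦ (hφs i i').smul (hψs i i')
  have hTE : sobolevEnergy K T ≤ cι * cι * (cι * cι) * (4 * ENNReal.ofReal ((Amax * Amax) ^ 2) * ENNReal.ofReal (δ ^ 2) * HS + Bpair * (1 + X1)) := by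
    have h1 := sobolevEnergy_sum_le_card K Finset.univ (f := fun i y ↦ ∑ i', φ i i' y • ψ i i' y)
      fun i _ ↦ (ContDiff.sum fun i' _ ↦ (hφs i i').smul (hψs i i')).of_le (by exact_mod_cast le_top)
    rw [Finset.card_univ, ← hT] at h1
    have h2 : ∀ i, sobolevEnergy K (fun y ↦ ∑ i', φ i i' y • ψ i i' y) ≤ cι * ∑ i', sobolevEnergy K (fun y ↦ φ i i' y • ψ i i' y) := by
      intro i
      have h := sobolevEnergy_sum_le_card K Finset.univ (f := fun i' y ↦ φ i i' y • ψ i i' y) fun i' _ ↦ ((hφs i i').smul (hψs i i')).of_le (by exact_mod_cast le_top)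
      rw [Finset.card_univ] at h
      exact h
    calc sobolevEnergy K T ≤ cι * ∑ i, (cι * ∑ i', sobolevEnergy K (fun y ↦ φ i i' y • ψ i i' y)) := h1.trans (mul_le_mul' le_rfl (Finset.sum_le_sum fun i _ ↦ h2 i))
      _ ≤ cι * ∑ _i : ι, (cι * ∑ _i' : ι, (4 * ENNReal.ofReal ((Amax * Amax) ^ 2) * ENNReal.ofReal (δ ^ 2) * HS + Bpair * (1 + X1))) :=
          mul_le_mul' le_rfl (Finset.sum_le_sum fun i _ ↦ mul_le_mul' le_rfl (Finset.sum_le_sum fun i' _ ↦ hprod i i'))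
      _ = _ := by rw [Finset.sum_const, Finset.sum_const, Finset.card_univ, nsmul_eq_mul, nsmul_eq_mul, hcι]; ring
  -- the cut-off remainder composite
  have hRr : sobolevEnergy K (fun y ↦ cut y • jetComp Gr 𝔷 y) ≤ Ccut * ENNReal.ofReal (Mcut ^ 2) * (Cr * (1 + Slow) * (1 + X1)) := by
    refine (hCcut hcut (contDiff_jetComp hGr h𝔷s) hcutb (hcutw K le_rfl)).trans (mul_le_mul' le_rfl ?_)
    refine (hCr h𝔷s (fun m hm y ↦ h𝔷b m (by omega) y) K le_rfl).trans ?_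
    calc Cr * (1 + ∑ m ∈ Finset.range (K + 1), sobolevEnergy m 𝔷) ≤ Cr * (1 + Slow * X1) := mul_le_mul' le_rfl (add_le_add le_rfl (h𝔷E K le_rfl))
      _ ≤ Cr * ((1 + Slow) * (1 + X1)) := by
          gcongr
          calc 1 + Slow * X1 ≤ 1 + Slow * X1 + (X1 + Slow) := le_self_add
            _ = (1 + Slow) * (1 + X1) := by ring
      _ = _ := by ring
  have heq : thetaFlat Av cut Gc Gr g₀ z = fun y ↦ (T y + cut y • jetComp Gr 𝔷 y) + g₀ y := by
    funext y
    simp only [thetaFlat, hT, hφ, hψ, h𝔷, jetComp_apply, smul_add, Finset.smul_sum]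
    congr 1
    congr 1
    exact Finset.sum_congr rfl fun i _ ↦ Finset.sum_congr rfl fun i' _ ↦ by rw [smul_comm]
  rw [heq]
  have hinner : ContDiff ℝ K fun y ↦ T y + cut y • jetComp Gr 𝔷 y := (hTs.add (hcut.smul (contDiff_jetComp hGr h𝔷s))).of_le (by exact_mod_cast le_top)
  refine (sobolevEnergy_add_le K hinner (hg₀.of_le (by exact_mod_cast le_top))).trans ?_
  refine (add_le_add (mul_le_mul' le_rfl (sobolevEnergy_add_le K (hTs.of_le (by exact_mod_cast le_top))
    ((hcut.smul (contDiff_jetComp hGr h𝔷s)).of_le (by exact_mod_cast le_top)))) le_rfl).trans ?_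
  calc 2 * (2 * sobolevEnergy K T + 2 * sobolevEnergy K (fun y ↦ cut y • jetComp Gr 𝔷 y)) + 2 * sobolevEnergy K g₀
      ≤ 2 * (2 * (cι * cι * (cι * cι) * (4 * ENNReal.ofReal ((Amax * Amax) ^ 2) * ENNReal.ofReal (δ ^ 2) * HS + Bpair * (1 + X1))) +
          2 * (Ccut * ENNReal.ofReal (Mcut ^ 2) * (Cr * (1 + Slow) * (1 + X1)))) + 2 * sobolevEnergy K g₀ :=
        add_le_add (mul_le_mul' le_rfl (add_le_add (mul_le_mul' le_rfl hTE) (mul_le_mul' le_rfl hRr))) le_rfl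
    _ ≤ ENNReal.ofReal (16 * (Fintype.card ι : ℝ) ^ 4 * Amax ^ 4 * δ ^ 2) * HS + B * (1 + X1) := by
        have hg1 : 2 * sobolevEnergy K g₀ ≤ 2 * sobolevEnergy K g₀ * (1 + X1) := le_mul_of_one_le_right' le_self_add
        have htopc : 2 * (2 * (cι * cι * (cι * cι) * (4 * ENNReal.ofReal ((Amax * Amax) ^ 2) * ENNReal.ofReal (δ ^ 2)))) =
            ENNReal.ofReal (16 * (Fintype.card ι : ℝ) ^ 4 * Amax ^ 4 * δ ^ 2) := by
          rw [hcι, ← ENNReal.ofReal_natCast, ← ENNReal.ofReal_ofNat, ← ENNReal.ofReal_ofNat]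
          have hc0 : (0 : ℝ) ≤ (Fintype.card ι : ℝ) := Nat.cast_nonneg _
          rw [← ENNReal.ofReal_mul hc0, ← ENNReal.ofReal_mul (by positivity), ← ENNReal.ofReal_mul (by positivity), ← ENNReal.ofReal_mul (by positivity),
            ← ENNReal.ofReal_mul (by positivity), ← ENNReal.ofReal_mul (by positivity), ← ENNReal.ofReal_mul (by positivity)]
          congr 1; ring
        calc _ = 2 * (2 * (cι * cι * (cι * cι) * (4 * ENNReal.ofReal ((Amax * Amax) ^ 2) * ENNReal.ofReal (δ ^ 2)))) * HS +
              ((4 * (cι * cι * (cι * cι)) * Bpair + 4 * (Ccut * ENNReal.ofReal (Mcut ^ 2) * (Cr * (1 + Slow)))) * (1 + X1) + 2 * sobolevEnergy K g₀) := by ring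
          _ ≤ _ := by
              rw [htopc, hB, add_mul _ (2 * sobolevEnergy K g₀) (1 + X1)]
              exact add_le_add le_rfl (add_le_add le_rfl hg1)

/-! ### The sharp flat estimate (difference form) -/

set_option maxHeartbeats 2400000 in
/-- **The sharp flat energy estimate (difference form).** For the data of the flat Picard source,
every order `K` and every `R` there is `B < ∞` such that for all smooth `z, z'` with
`‖Dᵐ z‖, ‖Dᵐ z'‖ ≤ R` (`m ≤ K + 2`) and `0 ≤ δ ≤ 1` bounding `|Gᶜᵢᵢ'(y, 𝔷 y)|`:
`E_K(Θ♭(z) - Θ♭(z')) ≤ 16 |ι|⁴ A⁴ δ² Σ_{ab} E_K(∂_a ∂_b (cut • (z - z'))) + B E_{K+1}(z - z')`;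
the top constant does not depend on `K`. [cite: TaylorPDEIII2011, Ch. 15, §7] -/
theorem energy_thetaFlat_sub_le_sharp (Av : ι → E') (K : ℕ) {cut : E' → ℝ} (hcut : ContDiff ℝ ∞ cut) (hcutc : HasCompactSupport cut)
    {Gc : ι → ι → (E' × (W × (E' →L[ℝ] W)) → ℝ)} (hGc : ∀ i i', ContDiff ℝ ∞ (Gc i i')) (hGcc : ∀ i i', HasCompactSupport (Gc i i'))
    {Gr : E' × (W × (E' →L[ℝ] W)) → W} (hGr : ContDiff ℝ ∞ Gr) (hGrc : HasCompactSupport Gr) (g₀ : E' → W) (R : ℝ) :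
    ∃ B : ℝ≥0∞, B ≠ ⊤ ∧ ∀ {z z' : E' → W}, ContDiff ℝ ∞ z → ContDiff ℝ ∞ z' →
      (∀ m ≤ K + 2, ∀ y, ‖iteratedFDeriv ℝ m z y‖ ≤ R) → (∀ m ≤ K + 2, ∀ y, ‖iteratedFDeriv ℝ m z' y‖ ≤ R) →
      ∀ {δ : ℝ}, 0 ≤ δ → δ ≤ 1 → (∀ i i' y, |Gc i i' (y, jetOf z y)| ≤ δ) →
      sobolevEnergy K (fun y ↦ thetaFlat Av cut Gc Gr g₀ z y - thetaFlat Av cut Gc Gr g₀ z' y) ≤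
        ENNReal.ofReal (16 * (Fintype.card ι : ℝ) ^ 4 * (∑ i, ‖Av i‖) ^ 4 * δ ^ 2) * hessEnergy K (fun y ↦ cut y • (z y - z' y)) +
          B * sobolevEnergy (K + 1) (fun y ↦ z y - z' y) := by
  classical
  /- ## constants -/
  obtain ⟨Mcut, hMcut0, hMcut⟩ := exists_forall_norm_iteratedFDeriv_le hcut hcutc K
  obtain ⟨Ccut, hCcuttop, hCcut⟩ := sobolevEnergy_smul_le_crude (E := E') (F := W) K
  obtain ⟨CcutK1, hCcutK1top, hCcutK1⟩ := sobolevEnergy_smul_le_crude (E := E') (F := W) (K - 1)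
  obtain ⟨CA', hCA'top, hCA'⟩ := sobolevEnergy_hessComp_le (E' := E') (W := W) (K - 1)
  obtain ⟨Chl, hChltop, hChl⟩ := sobolevEnergy_bilinear_highlow_sharp (E := E') (G₁ := ℝ) (G₂ := W) (F := W) K (ε := 1) one_pos le_rfl
  obtain ⟨Cf, hCftop, hCf⟩ := sobolevEnergy_fderiv_le (E' := E') (V := W) K
  obtain ⟨Cp, hCptop, hCp⟩ := sobolevEnergy_le_of_pointwise₂ (E := E') (F₁ := W) (F₂ := W × (E' →L[ℝ] W)) K
  have hcomm := fun i i' ↦ sobolevEnergy_hessComm_le (W := W) K hcut hcutc (Av i) (Av i')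
  choose Bc hBctop hBc using hcomm
  set Amax : ℝ := ∑ i, ‖Av i‖ with hAmax
  have hAmax0 : 0 ≤ Amax := Finset.sum_nonneg fun i _ ↦ norm_nonneg _
  have hAi : ∀ i, ‖Av i‖ ≤ Amax := fun i ↦ Finset.single_le_sum (f := fun i ↦ ‖Av i‖) (fun _ _ ↦ norm_nonneg _) (Finset.mem_univ i)
  set cι : ℝ≥0∞ := (Fintype.card ι : ℝ≥0∞) with hcι
  have ha := fun i i' ↦ norm_iteratedFDeriv_jetComp_le K (hGc i i') (hGcc i i') (|R| + |R|)
  choose Ca hCa0 hCa using ha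
  set Camax : ℝ := ∑ i, ∑ i', Ca i i' with hCamax
  have hCamax0 : 0 ≤ Camax := Finset.sum_nonneg fun i _ ↦ Finset.sum_nonneg fun i' _ ↦ hCa0 i i'
  have hCai : ∀ i i', Ca i i' ≤ Camax := fun i i' ↦ (Finset.single_le_sum (f := fun i' ↦ Ca i i') (fun _ _ ↦ hCa0 i _) (Finset.mem_univ i')).trans
    (Finset.single_le_sum (f := fun i ↦ ∑ i', Ca i i') (fun _ _ ↦ Finset.sum_nonneg fun _ _ ↦ hCa0 _ _) (Finset.mem_univ i))
  have hd := fun i i' ↦ norm_iteratedFDeriv_jetComp_sub_le K (hGc i i') (hGcc i i') (|R| + |R|)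
  choose Cd hCd0 hCd using hd
  set Cdmax : ℝ := ∑ i, ∑ i', Cd i i' with hCdmax
  have hCdmax0 : 0 ≤ Cdmax := Finset.sum_nonneg fun i _ ↦ Finset.sum_nonneg fun i' _ ↦ hCd0 i i'
  have hCdi : ∀ i i', Cd i i' ≤ Cdmax := fun i i' ↦ (Finset.single_le_sum (f := fun i' ↦ Cd i i') (fun _ _ ↦ hCd0 i _) (Finset.mem_univ i')).trans
    (Finset.single_le_sum (f := fun i ↦ ∑ i', Cd i i') (fun _ _ ↦ Finset.sum_nonneg fun _ _ ↦ hCd0 _ _) (Finset.mem_univ i))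
  obtain ⟨Cdr, hCdr0, hCdr⟩ := norm_iteratedFDeriv_jetComp_sub_le K hGr hGrc (|R| + |R|)
  set Bcmax : ℝ≥0∞ := ∑ i, ∑ i', Bc i i' with hBcmax
  have hBcmaxtop : Bcmax ≠ ⊤ := ENNReal.sum_ne_top.2 fun i _ ↦ ENNReal.sum_ne_top.2 fun i' _ ↦ hBctop i i'
  have hBci : ∀ i i', Bc i i' ≤ Bcmax := fun i i' ↦ (Finset.single_le_sum (f := fun i' ↦ Bc i i') (fun _ _ ↦ bot_le) (Finset.mem_univ i')).trans
    (Finset.single_le_sum (f := fun i ↦ ∑ i', Bc i i') (fun _ _ ↦ bot_le) (Finset.mem_univ i))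
  set Nψ : ℝ := 2 ^ K * Mcut * (Amax * Amax * |R|) with hNψ
  have hNψ0 : 0 ≤ Nψ := by positivity
  set Slow : ℝ≥0∞ := ((K + 1 : ℕ) : ℝ≥0∞) * (1 + Cf) with hSlow
  have hSlowtop : Slow ≠ ⊤ := ENNReal.mul_ne_top (ENNReal.natCast_ne_top _) (ENNReal.add_ne_top.2 ⟨ENNReal.one_ne_top, hCftop⟩)
  set Blow : ℝ≥0∞ := CcutK1 * ENNReal.ofReal (Mcut ^ 2) * (CA' * ENNReal.ofReal ((Amax * Amax) ^ 2)) with hBlow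
  have hBlowtop : Blow ≠ ⊤ := ENNReal.mul_ne_top (ENNReal.mul_ne_top hCcutK1top ENNReal.ofReal_ne_top) (ENNReal.mul_ne_top hCA'top ENNReal.ofReal_ne_top)
  set BA : ℝ≥0∞ := 4 * Bcmax + Chl * ((K : ℝ≥0∞) * ENNReal.ofReal (Camax ^ 2) * Blow) with hBA
  have hBAtop : BA ≠ ⊤ := ENNReal.add_ne_top.2 ⟨ENNReal.mul_ne_top (by norm_num) hBcmaxtop,
    ENNReal.mul_ne_top hChltop (ENNReal.mul_ne_top (ENNReal.mul_ne_top (ENNReal.natCast_ne_top _) ENNReal.ofReal_ne_top) hBlowtop)⟩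
  set BB : ℝ≥0∞ := Cp * ENNReal.ofReal ((2 ^ K * Cdmax * Nψ) ^ 2) * Slow with hBB
  have hBBtop : BB ≠ ⊤ := ENNReal.mul_ne_top (ENNReal.mul_ne_top hCptop ENNReal.ofReal_ne_top) hSlowtop
  set BC : ℝ≥0∞ := Ccut * ENNReal.ofReal (Mcut ^ 2) * (Cp * ENNReal.ofReal (Cdr ^ 2) * Slow) with hBC
  have hBCtop : BC ≠ ⊤ := ENNReal.mul_ne_top (ENNReal.mul_ne_top hCcuttop ENNReal.ofReal_ne_top) (ENNReal.mul_ne_top (ENNReal.mul_ne_top hCptop ENNReal.ofReal_ne_top) hSlowtop)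
  set B : ℝ≥0∞ := 4 * (cι * cι * (cι * cι)) * (BA + BB) + 2 * BC with hB
  refine ⟨B, ?_, fun {z z'} hz hz' hR hR' δ hδ0 hδ1 hδ ↦ ?_⟩
  · exact ENNReal.add_ne_top.2 ⟨ENNReal.mul_ne_top (ENNReal.mul_ne_top (by norm_num) (ENNReal.mul_ne_top
      (ENNReal.mul_ne_top (ENNReal.natCast_ne_top _) (ENNReal.natCast_ne_top _)) (ENNReal.mul_ne_top (ENNReal.natCast_ne_top _) (ENNReal.natCast_ne_top _))))
      (ENNReal.add_ne_top.2 ⟨hBAtop, hBBtop⟩), ENNReal.mul_ne_top (by norm_num) hBCtop⟩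
  /- ## the pieces -/
  obtain ⟨w, hw⟩ : ∃ w : E' → W, w = fun y ↦ z y - z' y := ⟨_, rfl⟩
  have hww : (fun y ↦ cut y • (z y - z' y)) = fun y ↦ cut y • w y := by rw [hw]
  rw [hww, ← hw]
  obtain ⟨ŵ, hŵ⟩ : ∃ ŵ : E' → W, ŵ = fun y ↦ cut y • w y := ⟨_, rfl⟩
  rw [← hŵ]
  have hws : ContDiff ℝ ∞ w := by rw [hw]; exact hz.sub hz'
  have hŵs : ContDiff ℝ ∞ ŵ := by rw [hŵ]; exact hcut.smul hws
  obtain ⟨𝔷, h𝔷⟩ : ∃ 𝔷 : E' → W × (E' →L[ℝ] W), 𝔷 = jetOf z := ⟨_, rfl⟩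
  obtain ⟨𝔷', h𝔷'⟩ : ∃ 𝔷' : E' → W × (E' →L[ℝ] W), 𝔷' = jetOf z' := ⟨_, rfl⟩
  have h𝔷s : ContDiff ℝ ∞ 𝔷 := by rw [h𝔷]; exact contDiff_jetOf hz
  have h𝔷's : ContDiff ℝ ∞ 𝔷' := by rw [h𝔷']; exact contDiff_jetOf hz'
  have h𝔷w : (fun y ↦ 𝔷 y - 𝔷' y) = jetOf w := by rw [h𝔷, h𝔷', hw]; exact jetOf_sub hz hz'
  have hD : ContDiff ℝ ∞ (fderiv ℝ z) := hz.fderiv_right (m := ∞) (by norm_cast)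
  have hD' : ContDiff ℝ ∞ (fderiv ℝ z') := hz'.fderiv_right (m := ∞) (by norm_cast)
  have hDD : ContDiff ℝ ∞ (fderiv ℝ (fderiv ℝ z)) := hD.fderiv_right (m := ∞) (by norm_cast)
  have hDD' : ContDiff ℝ ∞ (fderiv ℝ (fderiv ℝ z')) := hD'.fderiv_right (m := ∞) (by norm_cast)
  have hDDw : ContDiff ℝ ∞ (fderiv ℝ (fderiv ℝ w)) := (hws.fderiv_right (m := ∞) (by norm_cast)).fderiv_right (m := ∞) (by norm_cast)
  have h𝔷b : ∀ m ≤ K, ∀ y, ‖iteratedFDeriv ℝ m 𝔷 y‖ ≤ |R| + |R| := fun m hm y ↦ by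
    rw [h𝔷]; exact (norm_iteratedFDeriv_jetOf_le hz m y).trans
      (add_le_add ((hR m (by omega) y).trans (le_abs_self R)) ((hR (m + 1) (by omega) y).trans (le_abs_self R)))
  have h𝔷'b : ∀ m ≤ K, ∀ y, ‖iteratedFDeriv ℝ m 𝔷' y‖ ≤ |R| + |R| := fun m hm y ↦ by
    rw [h𝔷']; exact (norm_iteratedFDeriv_jetOf_le hz' m y).trans
      (add_le_add ((hR' m (by omega) y).trans (le_abs_self R)) ((hR' (m + 1) (by omega) y).trans (le_abs_self R)))
  set X1 := sobolevEnergy (K + 1) w with hX1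
  set HS := hessEnergy K ŵ with hHS
  have h𝔷E : ∑ m ∈ Finset.range (K + 1), sobolevEnergy m (jetOf w) ≤ Slow * X1 := by
    calc _ ≤ ∑ _m ∈ Finset.range (K + 1), (sobolevEnergy K w + sobolevEnergy K (fderiv ℝ w)) := by
          refine Finset.sum_le_sum fun m hm ↦ ?_
          have hm' : m ≤ K := Nat.lt_succ_iff.1 (Finset.mem_range.1 hm)
          exact (sobolevEnergy_jetOf_le m hws).trans (add_le_add (sobolevEnergy_mono hm' _) (sobolevEnergy_mono hm' _))
      _ = ((K + 1 : ℕ) : ℝ≥0∞) * (sobolevEnergy K w + sobolevEnergy K (fderiv ℝ w)) := by rw [Finset.sum_const, Finset.card_range, nsmul_eq_mul]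
      _ ≤ ((K + 1 : ℕ) : ℝ≥0∞) * (X1 + Cf * X1) := mul_le_mul' le_rfl (add_le_add (sobolevEnergy_mono (Nat.le_succ K) w) (hCf hws))
      _ = Slow * X1 := by rw [hSlow]; ring
  -- the cut-off Hessian components
  obtain ⟨ψ', hψ'⟩ : ∃ ψ' : ι → ι → E' → W, ψ' = fun i i' y ↦ cut y • fderiv ℝ (fderiv ℝ z') y (Av i) (Av i') := ⟨_, rfl⟩
  obtain ⟨ψw, hψw⟩ : ∃ ψw : ι → ι → E' → W, ψw = fun i i' y ↦ cut y • fderiv ℝ (fderiv ℝ w) y (Av i) (Av i') := ⟨_, rfl⟩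
  have hψ'0s : ∀ i i', ContDiff ℝ ∞ fun y ↦ fderiv ℝ (fderiv ℝ z') y (Av i) (Av i') := fun i i' ↦ (hDD'.clm_apply contDiff_const).clm_apply contDiff_const
  have hψw0s : ∀ i i', ContDiff ℝ ∞ fun y ↦ fderiv ℝ (fderiv ℝ w) y (Av i) (Av i') := fun i i' ↦ (hDDw.clm_apply contDiff_const).clm_apply contDiff_const
  have hψ's : ∀ i i', ContDiff ℝ ∞ (ψ' i i') := fun i i' ↦ by rw [hψ']; exact hcut.smul (hψ'0s i i')
  have hψws : ∀ i i', ContDiff ℝ ∞ (ψw i i') := fun i i' ↦ by rw [hψw]; exact hcut.smul (hψw0s i i')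
  have hψsub : ∀ i i' y, cut y • fderiv ℝ (fderiv ℝ z) y (Av i) (Av i') - cut y • fderiv ℝ (fderiv ℝ z') y (Av i) (Av i') = ψw i i' y := by
    intro i i' y
    have hev : fderiv ℝ w = fun y ↦ fderiv ℝ z y - fderiv ℝ z' y := by
      funext y; rw [hw]; exact fderiv_fun_sub ((hz.differentiable (by simp)) y) ((hz'.differentiable (by simp)) y)
    rw [hψw]
    show _ = cut y • fderiv ℝ (fderiv ℝ w) y (Av i) (Av i')
    rw [hev, fderiv_fun_sub ((hD.differentiable (by simp)) y) ((hD'.differentiable (by simp)) y), ← smul_sub]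
    rfl
  have hA4 : ∀ i i', ENNReal.ofReal ((‖Av i‖ * ‖Av i'‖) ^ 2) ≤ ENNReal.ofReal ((Amax * Amax) ^ 2) := fun i i' ↦
    ENNReal.ofReal_le_ofReal (pow_le_pow_left₀ (by positivity) (mul_le_mul (hAi i) (hAi i') (norm_nonneg _) hAmax0) 2)
  -- TOP (same chart)
  have hψwK : ∀ i i', sobolevEnergy K (ψw i i') ≤ 2 * (ENNReal.ofReal ((Amax * Amax) ^ 2) * HS) + 2 * (Bcmax * X1) := by
    intro i i'
    have heq : ψw i i' = fun y ↦ fderiv ℝ (fderiv ℝ ŵ) y (Av i) (Av i') +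
        -(fderiv ℝ cut y (Av i) • fderiv ℝ w y (Av i') + fderiv ℝ (fun y ↦ fderiv ℝ cut y (Av i')) y (Av i) • w y + fderiv ℝ cut y (Av i') • fderiv ℝ w y (Av i)) := by
      rw [hψw]; funext y
      show cut y • fderiv ℝ (fderiv ℝ w) y (Av i) (Av i') = _
      rw [smul_hess_apply_eq hcut hws y (Av i) (Av i'), hŵ, sub_eq_add_neg]
    rw [heq]
    have hs1 : ContDiff ℝ K fun y ↦ fderiv ℝ (fderiv ℝ ŵ) y (Av i) (Av i') :=
      ((((hŵs.fderiv_right (m := ∞) (by norm_cast)).fderiv_right (m := ∞) (by norm_cast)).clm_apply contDiff_const).clm_apply contDiff_const).of_le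
        (by exact_mod_cast le_top)
    have hDw : ContDiff ℝ ∞ (fderiv ℝ w) := hws.fderiv_right (m := ∞) (by norm_cast)
    have hm1 : ContDiff ℝ ∞ fun y ↦ fderiv ℝ cut y (Av i) := (hcut.fderiv_right (m := ∞) (by norm_cast)).clm_apply contDiff_const
    have hm3 : ContDiff ℝ ∞ fun y ↦ fderiv ℝ cut y (Av i') := (hcut.fderiv_right (m := ∞) (by norm_cast)).clm_apply contDiff_const
    have hm2 : ContDiff ℝ ∞ fun y ↦ fderiv ℝ (fun y ↦ fderiv ℝ cut y (Av i')) y (Av i) := (hm3.fderiv_right (m := ∞) (by norm_cast)).clm_apply contDiff_const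
    have hRs : ContDiff ℝ ∞ fun y ↦ fderiv ℝ cut y (Av i) • fderiv ℝ w y (Av i') + fderiv ℝ (fun y ↦ fderiv ℝ cut y (Av i')) y (Av i) • w y +
        fderiv ℝ cut y (Av i') • fderiv ℝ w y (Av i) :=
      ((hm1.smul (hDw.clm_apply contDiff_const)).add (hm2.smul hws)).add (hm3.smul (hDw.clm_apply contDiff_const))
    refine (sobolevEnergy_add_le K hs1 (hRs.neg.of_le (by exact_mod_cast le_top))).trans (add_le_add (mul_le_mul' le_rfl ?_) (mul_le_mul' le_rfl ?_))
    · refine (sobolevEnergy_hess_apply_le K hŵs (Av i) (Av i')).trans ?_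
      rw [hHS, hessEnergy_eq]
      exact mul_le_mul' (hA4 i i') le_rfl
    · rw [sobolevEnergy_neg K (hRs.of_le (by exact_mod_cast le_top))]
      exact (hBc i i' hws).trans (mul_le_mul' (hBci i i') le_rfl)
  -- LOW
  have hcutb : ∀ y, |cut y| ≤ Mcut := fun y ↦ by
    have h := hMcut 0 (Nat.zero_le _) y
    rwa [norm_iteratedFDeriv_zero, Real.norm_eq_abs] at h
  have hcutw : ∀ k ≤ K, ∀ l : List (Fin (Module.finrank ℝ E')), l ≠ [] → l.length ≤ k → ∀ y, ‖iterDirDeriv (l.map (stdOrthonormalBasis ℝ E')) cut y‖ ≤ Mcut := by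
    intro k hk l _ hl y
    have h := norm_iterDirDeriv_le hcut (l.map (stdOrthonormalBasis ℝ E')) y
    have hprod : ∏ i, ‖(l.map (stdOrthonormalBasis ℝ E')).get i‖ = 1 := Finset.prod_eq_one fun i _ ↦ by simp [(stdOrthonormalBasis ℝ E').orthonormal.1]
    rw [hprod, mul_one, List.length_map] at h
    exact h.trans (hMcut _ (hl.trans hk) y)
  have hψwlow : ∀ i i', ∀ j, 1 ≤ j → j ≤ K → sobolevEnergy (K - j) (ψw i i') ≤ Blow * X1 := by
    intro i i' j hj1 hjK
    have h1 : sobolevEnergy (K - j) (ψw i i') ≤ sobolevEnergy (K - 1) (ψw i i') := sobolevEnergy_mono (by omega) _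
    refine h1.trans ?_
    rw [hψw]
    refine (hCcutK1 hcut (hψw0s i i') hcutb (hcutw (K - 1) (by omega))).trans ?_
    calc CcutK1 * ENNReal.ofReal (Mcut ^ 2) * sobolevEnergy (K - 1) (fun y ↦ fderiv ℝ (fderiv ℝ w) y (Av i) (Av i'))
        ≤ CcutK1 * ENNReal.ofReal (Mcut ^ 2) * (CA' * ENNReal.ofReal ((‖Av i‖ * ‖Av i'‖) ^ 2) * sobolevEnergy (K - 1 + 2) w) := mul_le_mul' le_rfl (hCA' hws _ _)
      _ ≤ CcutK1 * ENNReal.ofReal (Mcut ^ 2) * (CA' * ENNReal.ofReal ((Amax * Amax) ^ 2) * X1) := by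
          rw [show K - 1 + 2 = K + 1 by omega]
          exact mul_le_mul' le_rfl (mul_le_mul' (mul_le_mul' le_rfl (hA4 i i')) le_rfl)
      _ = Blow * X1 := by rw [hBlow]; ring
  -- sup bounds of all derivatives up to `K` of `ψ'`
  have hψ'N : ∀ i i', ∀ m ≤ K, ∀ y, ‖iteratedFDeriv ℝ m (ψ' i i') y‖ ≤ Nψ := by
    intro i i' m hmK y
    rw [hψ']
    refine (norm_iteratedFDeriv_smul_le hcut (hψ'0s i i') y (n := m) (by exact_mod_cast le_top)).trans ?_
    have hterm : ∀ l ∈ Finset.range (m + 1), (m.choose l : ℝ) * ‖iteratedFDeriv ℝ l cut y‖ * ‖iteratedFDeriv ℝ (m - l) (fun y ↦ fderiv ℝ (fderiv ℝ z') y (Av i) (Av i')) y‖ ≤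
        (m.choose l : ℝ) * Mcut * (Amax * Amax * |R|) := by
      intro l hl
      have hl' : l ≤ m := Nat.lt_succ_iff.1 (Finset.mem_range.1 hl)
      obtain ⟨r, hr⟩ : ∃ r : ℕ, r = m - l := ⟨_, rfl⟩
      rw [← hr]
      have h1 := norm_iteratedFDeriv_clm_apply_const (f := fun y ↦ fderiv ℝ (fderiv ℝ z') y (Av i)) (c := Av i') (x := y) (N := ∞) (n := r)
        ((hDD'.clm_apply contDiff_const).contDiffAt) (by exact_mod_cast le_top)
      have h2 := norm_iteratedFDeriv_clm_apply_const (f := fderiv ℝ (fderiv ℝ z')) (c := Av i) (x := y) (N := ∞) (n := r)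
        hDD'.contDiffAt (by exact_mod_cast le_top)
      have h3 : ‖iteratedFDeriv ℝ r (fderiv ℝ (fderiv ℝ z')) y‖ ≤ |R| := by
        rw [norm_iteratedFDeriv_fderiv, norm_iteratedFDeriv_fderiv]
        exact (hR' (r + 1 + 1) (by omega) y).trans (le_abs_self R)
      have h4 : ‖iteratedFDeriv ℝ r (fun y ↦ fderiv ℝ (fderiv ℝ z') y (Av i) (Av i')) y‖ ≤ Amax * Amax * |R| :=
        calc _ ≤ ‖Av i'‖ * ‖iteratedFDeriv ℝ r (fun y ↦ fderiv ℝ (fderiv ℝ z') y (Av i)) y‖ := h1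
          _ ≤ ‖Av i'‖ * (‖Av i‖ * ‖iteratedFDeriv ℝ r (fderiv ℝ (fderiv ℝ z')) y‖) := mul_le_mul_of_nonneg_left h2 (norm_nonneg _)
          _ ≤ Amax * (Amax * |R|) := mul_le_mul (hAi i') (mul_le_mul (hAi i) h3 (norm_nonneg _) hAmax0) (by positivity) hAmax0
          _ = Amax * Amax * |R| := by ring
      exact mul_le_mul (mul_le_mul_of_nonneg_left (hMcut l (hl'.trans hmK) y) (Nat.cast_nonneg _)) h4 (norm_nonneg _) (by positivity)
    refine (Finset.sum_le_sum hterm).trans ?_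
    rw [← Finset.sum_mul, ← Finset.sum_mul]
    have h' : ∑ l ∈ Finset.range (m + 1), (m.choose l : ℝ) = 2 ^ m := by exact_mod_cast Nat.sum_range_choose m
    rw [h', hNψ]
    have h2 : (2 : ℝ) ^ m ≤ 2 ^ K := pow_le_pow_right₀ (by norm_num) hmK
    have : 0 ≤ Mcut * (Amax * Amax * |R|) := by positivity
    nlinarith
  -- the coefficient composites and their differences
  obtain ⟨φ, hφ⟩ : ∃ φ : ι → ι → E' → ℝ, φ = fun i i' ↦ jetComp (Gc i i') 𝔷 := ⟨_, rfl⟩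
  obtain ⟨φ', hφ'⟩ : ∃ φ' : ι → ι → E' → ℝ, φ' = fun i i' ↦ jetComp (Gc i i') 𝔷' := ⟨_, rfl⟩
  have hφs : ∀ i i', ContDiff ℝ ∞ (φ i i') := fun i i' ↦ by rw [hφ]; exact contDiff_jetComp (hGc i i') h𝔷s
  have hφ's : ∀ i i', ContDiff ℝ ∞ (φ' i i') := fun i i' ↦ by rw [hφ']; exact contDiff_jetComp (hGc i i') h𝔷's
  obtain ⟨Mφ, hMφ⟩ : ∃ Mφ : ℕ → ℝ, Mφ = fun j ↦ if j = 0 then δ else Camax := ⟨_, rfl⟩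
  have hMφ0 : Mφ 0 = δ := by simp [hMφ]
  have hφM : ∀ i i', ∀ j < K + 1, ∀ y, ‖iteratedFDeriv ℝ j (φ i i') y‖ ≤ Mφ j := by
    intro i i' j hj y
    rcases Nat.eq_zero_or_pos j with rfl | hjpos
    · rw [hMφ0, norm_iteratedFDeriv_zero, Real.norm_eq_abs, hφ, h𝔷]
      exact hδ i i' y
    · rw [show Mφ j = Camax by simp [hMφ, hjpos.ne'], hφ]
      exact (hCa i i' h𝔷s h𝔷b j (by omega) y).trans (hCai i i')
  have hφd : ∀ i i', ∀ m ≤ K, ∀ y, ‖iteratedFDeriv ℝ m (fun x ↦ φ i i' x - φ' i i' x) y‖ ≤ Cdmax * ∑ l ∈ Finset.range (m + 1), ‖iteratedFDeriv ℝ l (jetOf w) y‖ := by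
    intro i i' m hm y
    have h := hCd i i' h𝔷s h𝔷's h𝔷b h𝔷'b m hm y
    rw [h𝔷w] at h
    rw [hφ, hφ']
    exact h.trans (mul_le_mul_of_nonneg_right (hCdi i i') (Finset.sum_nonneg fun _ _ ↦ norm_nonneg _))
  /- ## Term A: `φ • ψw` by the sharp bound, all of `φ` in sup -/
  obtain ⟨Bs, hBs⟩ : ∃ Bs : ℝ →L[ℝ] W →L[ℝ] W, Bs = ContinuousLinearMap.lsmul ℝ ℝ := ⟨_, rfl⟩
  have hBsapp : ∀ (r : ℝ) (x : W), Bs r x = r • x := fun r x ↦ by rw [hBs]; rfl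
  have hBsn : ‖Bs‖ ≤ 1 := by rw [hBs]; exact ContinuousLinearMap.opNorm_lsmul_le
  have hδsq : ENNReal.ofReal (δ ^ 2) ≤ 1 := by
    rw [← ENNReal.ofReal_one]; exact ENNReal.ofReal_le_ofReal (by nlinarith)
  have hTA : ∀ i i', sobolevEnergy K (fun y ↦ φ i i' y • ψw i i' y) ≤ 4 * ENNReal.ofReal ((Amax * Amax) ^ 2) * ENNReal.ofReal (δ ^ 2) * HS + BA * X1 := by
    intro i i'
    have hfun : (fun y ↦ φ i i' y • ψw i i' y) = fun y ↦ Bs (φ i i' y) (ψw i i' y) := by funext y; rw [hBsapp]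
    rw [hfun]
    have hsharp := hChl Bs (hφs i i') (hψws i i') (h := K + 1) (by omega) le_rfl (Mφ := Mφ) (Nψ := 0) (hφM i i') le_rfl
      (fun m hm y ↦ absurd hm (by omega))
    rw [highLowQ'_eq, hMφ0] at hsharp
    refine hsharp.trans ?_
    have h1 : ENNReal.ofReal ((1 + 1) * (‖Bs‖ * δ) ^ 2) ≤ 2 * ENNReal.ofReal (δ ^ 2) := by
      rw [← ENNReal.ofReal_ofNat, ← ENNReal.ofReal_mul (by norm_num)]
      refine ENNReal.ofReal_le_ofReal ?_
      have h2 : (‖Bs‖ * δ) ^ 2 ≤ δ ^ 2 := by rw [mul_pow]; exact mul_le_of_le_one_left (sq_nonneg _) (by nlinarith [norm_nonneg Bs])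
      nlinarith
    have htop : ENNReal.ofReal ((1 + 1) * (‖Bs‖ * δ) ^ 2) * sobolevEnergy K (ψw i i') ≤
        4 * ENNReal.ofReal ((Amax * Amax) ^ 2) * ENNReal.ofReal (δ ^ 2) * HS + 4 * (Bcmax * X1) := by
      refine (mul_le_mul' h1 (hψwK i i')).trans ?_
      rw [mul_add]
      refine add_le_add (le_of_eq (by ring)) ?_
      calc 2 * ENNReal.ofReal (δ ^ 2) * (2 * (Bcmax * X1)) ≤ 2 * 1 * (2 * (Bcmax * X1)) := mul_le_mul' (mul_le_mul' le_rfl hδsq) le_rfl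
        _ = 4 * (Bcmax * X1) := by ring
    have hB1 : ENNReal.ofReal (‖Bs‖ ^ 2) ≤ 1 := by rw [← ENNReal.ofReal_one]; exact ENNReal.ofReal_le_ofReal (by nlinarith [norm_nonneg Bs])
    have hsup : ∑ j ∈ Finset.Ico 1 (K + 1), ENNReal.ofReal (Mφ j ^ 2) * sobolevEnergy (K - j) (ψw i i') ≤ (K : ℝ≥0∞) * ENNReal.ofReal (Camax ^ 2) * Blow * X1 := by
      calc _ ≤ ∑ _j ∈ Finset.Ico 1 (K + 1), ENNReal.ofReal (Camax ^ 2) * (Blow * X1) := by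
            refine Finset.sum_le_sum fun j hj ↦ ?_
            obtain ⟨hj1, hjK⟩ := Finset.mem_Ico.1 hj
            rw [show Mφ j = Camax by simp [hMφ, (show j ≠ 0 by omega)]]
            exact mul_le_mul' le_rfl (hψwlow i i' j hj1 (by omega))
        _ = (K : ℝ≥0∞) * (ENNReal.ofReal (Camax ^ 2) * (Blow * X1)) := by
            rw [Finset.sum_const, nsmul_eq_mul, Nat.card_Ico, Nat.add_sub_cancel]
        _ = _ := by ring
    have hempty : ENNReal.ofReal ((0 : ℝ) ^ 2) * ∑ j ∈ Finset.Ico (K + 1) (K + 1), sobolevEnergy j (φ i i') = 0 := by simp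
    rw [hempty, add_zero]
    calc ENNReal.ofReal ((1 + 1) * (‖Bs‖ * δ) ^ 2) * sobolevEnergy K (ψw i i') +
          Chl * ENNReal.ofReal (‖Bs‖ ^ 2) * ∑ j ∈ Finset.Ico 1 (K + 1), ENNReal.ofReal (Mφ j ^ 2) * sobolevEnergy (K - j) (ψw i i')
        ≤ (4 * ENNReal.ofReal ((Amax * Amax) ^ 2) * ENNReal.ofReal (δ ^ 2) * HS + 4 * (Bcmax * X1)) + Chl * 1 * ((K : ℝ≥0∞) * ENNReal.ofReal (Camax ^ 2) * Blow * X1) :=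
          add_le_add htop (mul_le_mul' (mul_le_mul' le_rfl hB1) hsup)
      _ = _ := by rw [hBA]; ring
  /- ## Term B: `(φ - φ') • ψ'` pointwise -/
  have hTB : ∀ i i', sobolevEnergy K (fun y ↦ (φ i i' y - φ' i i' y) • ψ' i i' y) ≤ BB * X1 := by
    intro i i'
    have hsm : ContDiff ℝ ∞ fun y ↦ (φ i i' y - φ' i i' y) • ψ' i i' y := ((hφs i i').sub (hφ's i i')).smul (hψ's i i')
    have hdom : ∀ m ≤ K, ∀ y, ‖iteratedFDeriv ℝ m (fun y ↦ (φ i i' y - φ' i i' y) • ψ' i i' y) y‖ ≤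
        (2 ^ K * Cdmax * Nψ) * ∑ l ∈ Finset.range (m + 1), ‖iteratedFDeriv ℝ l (jetOf w) y‖ := by
      intro m hm y
      refine (norm_iteratedFDeriv_smul_le ((hφs i i').sub (hφ's i i')) (hψ's i i') y (n := m) (by exact_mod_cast le_top)).trans ?_
      set S := ∑ l ∈ Finset.range (m + 1), ‖iteratedFDeriv ℝ l (jetOf w) y‖ with hS
      have hS0 : 0 ≤ S := Finset.sum_nonneg fun _ _ ↦ norm_nonneg _
      calc ∑ l ∈ Finset.range (m + 1), (m.choose l : ℝ) * ‖iteratedFDeriv ℝ l (fun x ↦ φ i i' x - φ' i i' x) y‖ * ‖iteratedFDeriv ℝ (m - l) (ψ' i i') y‖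
          ≤ ∑ l ∈ Finset.range (m + 1), (m.choose l : ℝ) * (Cdmax * S) * Nψ := by
            refine Finset.sum_le_sum fun l hl ↦ ?_
            have hl' : l ≤ m := Nat.lt_succ_iff.1 (Finset.mem_range.1 hl)
            refine mul_le_mul (mul_le_mul_of_nonneg_left ((hφd i i' l (by omega) y).trans ?_) (Nat.cast_nonneg _)) (hψ'N i i' (m - l) (by omega) y)
              (norm_nonneg _) (mul_nonneg (Nat.cast_nonneg _) (mul_nonneg hCdmax0 hS0))
            exact mul_le_mul_of_nonneg_left (Finset.sum_le_sum_of_subset_of_nonneg (Finset.range_mono (by omega)) fun _ _ _ ↦ norm_nonneg _) hCdmax0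
        _ = (2 ^ m * Cdmax * Nψ) * S := by
            rw [← Finset.sum_mul, ← Finset.sum_mul]
            have h' : ∑ l ∈ Finset.range (m + 1), (m.choose l : ℝ) = 2 ^ m := by exact_mod_cast Nat.sum_range_choose m
            rw [h']; ring
        _ ≤ (2 ^ K * Cdmax * Nψ) * S := by
            refine mul_le_mul_of_nonneg_right ?_ hS0
            have h2 : (2 : ℝ) ^ m ≤ 2 ^ K := pow_le_pow_right₀ (by norm_num) hm
            have : 0 ≤ Cdmax * Nψ := by positivity
            nlinarith
    refine (hCp hsm (contDiff_jetOf hws) (by positivity) hdom).trans ?_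
    calc Cp * ENNReal.ofReal ((2 ^ K * Cdmax * Nψ) ^ 2) * ∑ l ∈ Finset.range (K + 1), sobolevEnergy l (jetOf w)
        ≤ Cp * ENNReal.ofReal ((2 ^ K * Cdmax * Nψ) ^ 2) * (Slow * X1) := mul_le_mul' le_rfl h𝔷E
      _ = BB * X1 := by rw [hBB]; ring
  /- ## Term C: the cut-off remainder difference -/
  have hTC : sobolevEnergy K (fun y ↦ cut y • (jetComp Gr 𝔷 y - jetComp Gr 𝔷' y)) ≤ BC * X1 := by
    have hsm : ContDiff ℝ ∞ fun y ↦ jetComp Gr 𝔷 y - jetComp Gr 𝔷' y := (contDiff_jetComp hGr h𝔷s).sub (contDiff_jetComp hGr h𝔷's)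
    have hdom : ∀ m ≤ K, ∀ y, ‖iteratedFDeriv ℝ m (fun y ↦ jetComp Gr 𝔷 y - jetComp Gr 𝔷' y) y‖ ≤ Cdr * ∑ l ∈ Finset.range (m + 1), ‖iteratedFDeriv ℝ l (jetOf w) y‖ := by
      intro m hm y
      have h := hCdr h𝔷s h𝔷's h𝔷b h𝔷'b m hm y
      rwa [h𝔷w] at h
    refine (hCcut hcut hsm hcutb (hcutw K le_rfl)).trans ?_
    refine (mul_le_mul' le_rfl ((hCp hsm (contDiff_jetOf hws) hCdr0 hdom).trans (mul_le_mul' le_rfl h𝔷E))).trans_eq ?_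
    rw [hBC]; ring
  /- ## assembly -/
  obtain ⟨Tdiff, hTdiff⟩ : ∃ Tdiff : E' → W, Tdiff = fun y ↦ ∑ i, ∑ i', (φ i i' y • ψw i i' y + (φ i i' y - φ' i i' y) • ψ' i i' y) := ⟨_, rfl⟩
  have hpair : ∀ i i', ContDiff ℝ ∞ fun y ↦ φ i i' y • ψw i i' y + (φ i i' y - φ' i i' y) • ψ' i i' y := fun i i' ↦
    ((hφs i i').smul (hψws i i')).add (((hφs i i').sub (hφ's i i')).smul (hψ's i i'))
  have hTdiffs : ContDiff ℝ ∞ Tdiff := by rw [hTdiff]; exact ContDiff.sum fun i _ ↦ ContDiff.sum fun i' _ ↦ hpair i i'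
  have hTdiffE : sobolevEnergy K Tdiff ≤ cι * cι * (cι * cι) * (2 * (4 * ENNReal.ofReal ((Amax * Amax) ^ 2) * ENNReal.ofReal (δ ^ 2) * HS + (BA + BB) * X1)) := by
    have hterm : ∀ i i', sobolevEnergy K (fun y ↦ φ i i' y • ψw i i' y + (φ i i' y - φ' i i' y) • ψ' i i' y) ≤
        2 * (4 * ENNReal.ofReal ((Amax * Amax) ^ 2) * ENNReal.ofReal (δ ^ 2) * HS + (BA + BB) * X1) := by
      intro i i'
      refine (sobolevEnergy_add_le K (((hφs i i').smul (hψws i i')).of_le (by exact_mod_cast le_top))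
        ((((hφs i i').sub (hφ's i i')).smul (hψ's i i')).of_le (by exact_mod_cast le_top))).trans ?_
      calc 2 * sobolevEnergy K (fun y ↦ φ i i' y • ψw i i' y) + 2 * sobolevEnergy K (fun y ↦ (φ i i' y - φ' i i' y) • ψ' i i' y)
          ≤ 2 * (4 * ENNReal.ofReal ((Amax * Amax) ^ 2) * ENNReal.ofReal (δ ^ 2) * HS + BA * X1) + 2 * (BB * X1) :=
            add_le_add (mul_le_mul' le_rfl (hTA i i')) (mul_le_mul' le_rfl (hTB i i'))
        _ = _ := by ring
    have h1 := sobolevEnergy_sum_le_card K Finset.univ (f := fun i y ↦ ∑ i', (φ i i' y • ψw i i' y + (φ i i' y - φ' i i' y) • ψ' i i' y))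
      fun i _ ↦ (ContDiff.sum fun i' _ ↦ hpair i i').of_le (by exact_mod_cast le_top)
    rw [Finset.card_univ, ← hTdiff] at h1
    have h2 : ∀ i, sobolevEnergy K (fun y ↦ ∑ i', (φ i i' y • ψw i i' y + (φ i i' y - φ' i i' y) • ψ' i i' y)) ≤
        cι * ∑ i', sobolevEnergy K (fun y ↦ φ i i' y • ψw i i' y + (φ i i' y - φ' i i' y) • ψ' i i' y) := by
      intro i
      have h := sobolevEnergy_sum_le_card K Finset.univ (f := fun i' y ↦ φ i i' y • ψw i i' y + (φ i i' y - φ' i i' y) • ψ' i i' y)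
        fun i' _ ↦ (hpair i i').of_le (by exact_mod_cast le_top)
      rw [Finset.card_univ] at h
      exact h
    calc sobolevEnergy K Tdiff ≤ cι * ∑ i, (cι * ∑ i', sobolevEnergy K (fun y ↦ φ i i' y • ψw i i' y + (φ i i' y - φ' i i' y) • ψ' i i' y)) :=
          h1.trans (mul_le_mul' le_rfl (Finset.sum_le_sum fun i _ ↦ h2 i))
      _ ≤ cι * ∑ _i : ι, (cι * ∑ _i' : ι, (2 * (4 * ENNReal.ofReal ((Amax * Amax) ^ 2) * ENNReal.ofReal (δ ^ 2) * HS + (BA + BB) * X1))) :=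
          mul_le_mul' le_rfl (Finset.sum_le_sum fun i _ ↦ mul_le_mul' le_rfl (Finset.sum_le_sum fun i' _ ↦ hterm i i'))
      _ = _ := by rw [Finset.sum_const, Finset.sum_const, Finset.card_univ, nsmul_eq_mul, nsmul_eq_mul, hcι]; ring
  have heq : (fun y ↦ thetaFlat Av cut Gc Gr g₀ z y - thetaFlat Av cut Gc Gr g₀ z' y) = fun y ↦ Tdiff y + cut y • (jetComp Gr 𝔷 y - jetComp Gr 𝔷' y) := by
    funext y
    have hsub' : ∀ i i', φ i i' y • ψw i i' y = φ i i' y • (cut y • fderiv ℝ (fderiv ℝ z) y (Av i) (Av i')) - φ i i' y • (cut y • fderiv ℝ (fderiv ℝ z') y (Av i) (Av i')) := by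
      intro i i'; rw [← hψsub i i' y, smul_sub]
    simp only [hTdiff]
    simp only [hsub']
    simp only [thetaFlat, hφ, hφ', hψ', jetComp_apply, h𝔷, h𝔷', jetOf_apply]
    simp only [smul_add, smul_sub, sub_smul, Finset.smul_sum, Finset.sum_add_distrib, Finset.sum_sub_distrib, smul_comm (cut y)]
    abel
  rw [heq]
  have hCs : ContDiff ℝ K fun y ↦ cut y • (jetComp Gr 𝔷 y - jetComp Gr 𝔷' y) :=
    (hcut.smul ((contDiff_jetComp hGr h𝔷s).sub (contDiff_jetComp hGr h𝔷's))).of_le (by exact_mod_cast le_top)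
  refine (sobolevEnergy_add_le K (hTdiffs.of_le (by exact_mod_cast le_top)) hCs).trans ?_
  calc 2 * sobolevEnergy K Tdiff + 2 * sobolevEnergy K (fun y ↦ cut y • (jetComp Gr 𝔷 y - jetComp Gr 𝔷' y))
      ≤ 2 * (cι * cι * (cι * cι) * (2 * (4 * ENNReal.ofReal ((Amax * Amax) ^ 2) * ENNReal.ofReal (δ ^ 2) * HS + (BA + BB) * X1))) + 2 * (BC * X1) :=
        add_le_add (mul_le_mul' le_rfl hTdiffE) (mul_le_mul' le_rfl hTC)
    _ = ENNReal.ofReal (16 * (Fintype.card ι : ℝ) ^ 4 * Amax ^ 4 * δ ^ 2) * HS + B * X1 := by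
        have htopc : 2 * (cι * cι * (cι * cι) * (2 * (4 * ENNReal.ofReal ((Amax * Amax) ^ 2) * ENNReal.ofReal (δ ^ 2)))) =
            ENNReal.ofReal (16 * (Fintype.card ι : ℝ) ^ 4 * Amax ^ 4 * δ ^ 2) := by
          rw [hcι, ← ENNReal.ofReal_natCast, ← ENNReal.ofReal_ofNat, ← ENNReal.ofReal_ofNat]
          have hc0 : (0 : ℝ) ≤ (Fintype.card ι : ℝ) := Nat.cast_nonneg _
          rw [← ENNReal.ofReal_mul hc0, ← ENNReal.ofReal_mul (by positivity), ← ENNReal.ofReal_mul (by positivity), ← ENNReal.ofReal_mul (by positivity),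
            ← ENNReal.ofReal_mul (by positivity), ← ENNReal.ofReal_mul (by positivity), ← ENNReal.ofReal_mul (by positivity)]
          congr 1; ring
        rw [← htopc, hB]; ring

end Theta

end Literature.Analysis.PDE
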